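import Literature.MathematicalPhysics.QuantumFieldTheory.Balaban1983to89.BlockAveragingPlaquetteBound
import Literature.MathematicalPhysics.QuantumFieldTheory.Balaban1983to89.BlockAveragingFederbush
import Literature.MathematicalPhysics.QuantumFieldTheory.Balaban1983to89.B7

/-!
# `Balaban1983to89.BlockAveragingEMLProp2` — [Balaban1985Averaging] PROPOSITIONS 1–2 (51)–(54) FOR THE SYMMETRIC BLOCK AVERAGING (0.4) OF
# [Balaban1987RG1] WITH THE PRINTED `exp[mean log]` ON `SU(N)`, SHARP (SECOND-ORDER) AND UNIFORM IN THE NUMBER OF AVERAGINGS — PROVED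

T. Bałaban, *Averaging operations for lattice gauge theories*, Commun. Math. Phys. **98** (1985) 17–51 [Balaban1985Averaging] (cell paper B7;
held `paper:balaban1985-cmp98-averaging`, journal page = PDF page + 16), Proposition 1 (51) and Proposition 2 (52)–(54) p. 26 [PDF 10]; T. Bałaban,
*Renormalization group approach to lattice gauge field theories. I*, Commun. Math. Phys. **109** (1987) 249–301 [Balaban1987RG1] (cell paper B12 = «[I]»),
(0.3)–(0.4) pp. 252–253 and p. 253, verbatim: *«The considerations and results of this, and previous papers, do not depend on any particular averaging
operation used; they are valid universally for all averages satisfying the above properties.»*  [B7] p. 26, verbatim (from the tree leaf `B7.Prop1Printed` ∕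
`B7.Prop2Printed`, which READ the page): *«There exist positive constants C₀, c′₂ such that for every configuration V satisfying (44) for p ⊂ Δ(p′) and
for α₀ ≤ c′₂, we have |V̄(∂p′) − 1| < L²α₀ + C₀(L²α₀)² (51).  The constant C₀ depends on d and c′₂ depends on d and L.»*; *«Proposition 2. If U satisfies
(52) with α₀ ≦ c₂ = min{1/(3C₀), ½c′₂}, then |Ū^k(∂p) − 1| < α₀ + 2C₀α₀² < 2α₀, p ⊂ Ω^{(k)}. (54)»*.

Cell `pub-ymgap` (HUMAN RULING D-0062, YM-PLAN Track A), node N21 = NE7c, seat `pub-ymgap-dag-n21-c` (generation 2; director-ym R134 row s1, successor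
item S4 of the seat's g0 HANDOFF: the one-call END's γ3 readings `hcore`∕`hcollar` — «slot variable of the minimiser `< εη_k²` ⇒ datum `a`-small on the
box» — are [B7] Prop. 2 READ AT THE AVERAGING OF RECORD, and a supplier census found none); `--supports stmt-QuantumFields-19676`.

WHY THIS FILE EXISTS.  The tree certifies Propositions 1–2 for [B7]'s OWN average (42)–(43) on `ℤᵈ` (`B7Prop1Explicit.prop1_explicit`,
`B7Prop2Explicit.prop2_explicit`, `B10Eq44AvgRegularity`, on the torus through the periodic pullback `B10Eq69TorusPullback.prop2_level_torus`).  The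
averaging OF RECORD of the T⁴ programme is a DIFFERENT map: [I]'s symmetric (0.3)–(0.4) `BlockAveraging.blockAvg ExpMeanLog.expMeanLogSU`
(`Node00.avOfRecord`, `T4Continuum.FiniteEpsData.IsPrintedAveraged₁`), for which the tree had ONLY the crude one-step bound
`BlockAveragingPlaquetteBound.plaqSmall_blockAvg_expMeanLogSU` — constant `(L² + 6((d+2)L)²)·a`, which iterates to `(1 + 6(d+2)²)^k·α₀`, exponential
in the number of levels and useless for (53) — and the UNPROVED schema `T3LowerAlongMinimisersSplit.Prop1EmlAt` («asserted in print», struck from the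
`UnitScaleTilt` route's stubs at the price `151·B₃θ ≤ ε₀`).  Here both propositions are PROVED for (0.4), for every `d`, `L`, `N`, torus and level.

THE MECHANISM (why the symmetric definition matters).  `Ū(c) = κ_c·U(c)` with `κ_c = exp[|I|⁻¹ Σ_i log W_i]`, the `W_i` the (0.4) loop variables
`U(Γ^σ_{c₋→x})·U([x, x′])·U(Γ^{σ′}_{c₊→x′})⁻¹·U(c)⁻¹` (`loopHol_eq`), all within `θ = (((d+2)L)²/4)·a` of `1` (`LatticeWordStokes`).  To second order
`κ_c = 1 + |I|⁻¹Σ_i (W_i − 1)` (`norm_eml_sub_one_sub_mean_le`, from the tree's `norm_mlog_sub_sub_one_le` and `OneLinkLaplace.norm_exp_sub_one_sub_le_sq`).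
Around `∂p′ = c₁c₂c₃⁻¹c₄⁻¹`, `Ū(∂p′) = κ₁·(S₁κ₂S₁⁻¹)·Q·(S₄κ₃⁻¹S₄⁻¹)·κ₄⁻¹` (`plaqHol_avgFun_eq_five`; `S_i = U(c_i)`, `Q` the straight coarse square).
COUPLE the four index families by one offset `n` and orderings `(σ, τ, ρ, ω)` — `c₁` read at `(σ, τ)`, `c₂` at `(τ, ρ)`, `c₃` at `(ω, ρ)`, `c₄` at `(σ, ω)`;
each marginal is uniform (`mean_couple₁₂∕₂₃∕₅₄∕₁₅`), and because (0.3) attaches ONE staircase family to each BLOCK POINT, the same for both bonds at that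
point, the staircases shared by consecutive bonds CANCEL: the product of the four coupled loop variables is `Z·Q⁻¹·Z⁻¹·(T^σ·U(∂(p′)_x)·(T^σ)⁻¹)`
(`prod_four_loopHol_eq`, a free-group identity `key_group_identity` after the torus bookkeeping of §2), `(p′)_x` the coarse square translated to the fine
site `x = emb y + n` — within `L²a` of `1` by exact lattice Stokes (`B10Eq47AxialChi.dist1_rect_le`) — and `Z` a transport loop within
`s = (((d+4)L)²/4)·a` of `1`.  Hence the first-order terms sum to the offset-mean of `U(∂(p′)_x) − 1` plus commutator∕inverse-pair terms of second order
(`norm_key_identity_le`), and `|Ū(∂p′) − 1| ≤ L²a + 143·s² = L²a + C₀(d)(L²a)²`, `C₀(d) = 143·((d+4)²/4)²` (§7).  No gauge fixing, no range hypothesis.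

WHAT IS PROVED (kernel; 0 `def`, 0 `sorry`; every cited input BY NAME).
* §1 normed-algebra letters: `norm_prod_sub_one_sub_sum_le` (products of near-`1` elements to second order), `norm_prod_five_sub_le`,
  `norm_prod_four_sub_le`, `norm_conj_sub_self_le` (commutator), `norm_inv_add_self_sub_two_le`, `norm_key_identity_le`; §1b `norm_eml_sub_one_sub_mean_le`
  (**`exp[mean log]` to second order**: `‖eml W − 1 − |I|⁻¹Σ(W_i − 1)‖ ≤ 6t²` for `‖W_i − 1‖ ≤ t ≤ ¼`), `eml_comp_equiv'`.
* §2 torus words: `holAt_walk_replicate_true` (straight walks = `rowProd`), `walkEnd_stairWord_shift`, **`loopHol_eq`** (the (0.4) loop variable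
  factorised into its four segments), `plaqHol_avgFun_eq_five`, `dist1_rect_LL_le`, `netDisp_zWord`∕`length_zWord_le`∕`holAt_zWord_eq` (the transport loop).
* §3 the coupling identities `mean_couple₁₂`, `mean_couple₂₃`, `mean_couple₅₄`, `mean_couple₁₅`.
* §4 `SU(N)`: `coe_avg_eq_eml`, **`norm_corr_sub_mean_le`** ∕ `norm_corr_inv_sub_mean_le` (the correction factor of (0.4) and its inverse to second order).
* §5 **`prod_four_loopHol_eq`** (THE TELESCOPING), `dist1_loopHol_le'`, `dist1_zWord_le` (non-strict levels via the limiting letter `le_mul_of_forall_gt`).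
* §6 `coupled_first_order_le` (per coupled index: `‖Σₖ(aₖ − 1) + (Q − 1)‖ ≤ L²a + 15s²`), `dist1_corr_le_two_mul`.
* §7 **`dist1_plaqHol_avgFun_le`** = PROPOSITION 1 (51) FOR (0.4): `∀ q, |U(∂q) − 1| ≤ a`, `(((d+4)L)²/4)·a ≤ δ_N/2` ⇒
  `|Ū(∂p′) − 1| ≤ L²a + 143·((((d+4)L)²/4)·a)²`; **`plaqSmall_blockAvg_eml_sharp`** (the `PlaqSmall` form — the shape of `Prop1EmlAt` for every `d`, `N`).
* §8 **`plaqSmall_iter_blockAvg_eml`** = PROPOSITION 2 (52) ⇒ (54) FOR (0.4), UNIFORM IN `k`: `PlaqSmall (α₀·(L^k)⁻²) U`, `C₀(d)α₀ ≤ ⅓`,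
  `2α₀ ≤ c′₂ = 2δ_N/((d+4)L)²` ⇒ `PlaqSmall (α₀ + 2C₀(d)α₀²) (Averaging.iter (fun _ => blockAvg ℰp) k U)` — the (53) induction is the tree's
  `B7.prop2_of_ineq53` BY NAME; `plaqSmall_iter_blockAvg_eml_level` (all levels `j ≤ k`: `< 2α₀(L^jη)²`, (53) via `B7.ineq53_induction`);
  `plaqSmall_iter_blockAvg_eml_eta` (`PlaqSmall (α₀η_k²) U ⇒ PlaqSmall (2α₀) Ū^k`, `η_k = Params.eta k`).
Constants are explicit but not optimised (`C₀(4) = 143·16² = 36608`; the radius `δ_N = min(1/3, π/N)` of the tree's guarded `expMeanLogSU` makes `c′₂`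
depend on `N` as well as on `d`, `L`).  The LOCAL form of Prop. 1 («it is enough to assume (52) for p ⊂ B^k(x) ∪ …») is not typed here (the Stokes letters of
`LatticeWordStokes` are global); the global form is what (53)–(54) on the torus consume.
* v1.1 (seat generation 3, ATOMISED PROP. 1 for the local form): **`coupled_first_order_le_of_atoms`**, **`dist1_plaqHol_avgFun_le_of_atoms`** — the same
  estimates with the configuration entering ONLY through the sizes of the atoms the proof consumes (the loop variables at the four bonds of `∂p′`, the
  transport loops `Z`, the straight and the translated coarse squares); `coupled_first_order_le` ∕ `dist1_plaqHol_avgFun_le` are now their instances at the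
  global letters (statements of v1.0 unchanged).  A walk-local smallness hypothesis near the four blocks of `p′` bounds every atom (the tree's local Stokes
  letters `HistoryTailStokesLocal.dist1_holAt_le_loc` ∕ `dist1_loopHol_le_loc`, `B10Eq47AxialChi.dist1_rect_le`), which is how the Summits-side companion
  `Summit.QuantumFields.YangMills.Theorems.N21LocalAveragedRegularity` obtains the printed LOCAL Props. 1–2 for (0.4).

HONEST FRAMING.  A kernel proof of two printed estimates of [B7] for the averaging the T⁴ programme actually uses ([I] (0.4)); it asserts nothing else of
Bałaban's, proves no node of `YM-PLAN` (N04 = [B7] is discharged at [B7]'s own average, R431, untouched; N21 = NE7c NOT PRINTED, NOT PROVED), moves no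
count (5∕27); one finite torus at fixed `ε` — NOT continuum ∕ ℝ⁴ ∕ infinite volume ∕ OS ∕ mass gap ∕ Clay.  New sibling module; nothing in the tree is modified.
-/

noncomputable section

open scoped BigOperators

namespace Literature.MathematicalPhysics.QuantumFieldTheory.Balaban1983to89.BlockAveragingEMLProp2

/-! ## §1 Second-order letters in a normed algebra -/

section Algebra

open ExpMeanLog MatrixLog B7BlockAvgLog NormedSpace

variable {𝔸 : Type*} [NormedRing 𝔸]

/-- `‖∏ xᵢ − 1‖ ≤ (1+b)^n − 1` for a list of `n` elements within `b` of `1`. [folklore] -/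
private theorem norm_prod_sub_one_le (b : ℝ) (hb : 0 ≤ b) :
    ∀ l : List 𝔸, (∀ x ∈ l, ‖x - 1‖ ≤ b) → ‖l.prod - 1‖ ≤ (1 + b) ^ l.length - 1
  | [], _ => by simp
  | x :: l, h => by
    have hx : ‖x - 1‖ ≤ b := h x (by simp)
    have ih := norm_prod_sub_one_le b hb l fun y hy => h y (by simp [hy])
    have hP : 0 ≤ (1 + b) ^ l.length - 1 := by
      have : (1 : ℝ) ≤ (1 + b) ^ l.length := one_le_pow₀ (by linarith)
      linarith
    rw [List.prod_cons, List.length_cons]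
    have e : x * l.prod - 1 = (x - 1) * (l.prod - 1) + (x - 1) + (l.prod - 1) := by noncomm_ring
    rw [e]
    calc ‖(x - 1) * (l.prod - 1) + (x - 1) + (l.prod - 1)‖
        ≤ ‖x - 1‖ * ‖l.prod - 1‖ + ‖x - 1‖ + ‖l.prod - 1‖ :=
          (norm_add_le _ _).trans (add_le_add ((norm_add_le _ _).trans (add_le_add (norm_mul_le _ _) le_rfl)) le_rfl)
      _ ≤ b * ((1 + b) ^ l.length - 1) + b + ((1 + b) ^ l.length - 1) := by
          gcongr
      _ = (1 + b) ^ (l.length + 1) - 1 := by ring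

/-- **Products of near-`1` elements to second order**: `‖∏ xᵢ − 1 − Σ (xᵢ − 1)‖ ≤ (1+b)^n − 1 − n·b` for a list of `n`
elements within `b` of `1`. [folklore] -/
private theorem norm_prod_sub_one_sub_sum_le (b : ℝ) (hb : 0 ≤ b) :
    ∀ l : List 𝔸, (∀ x ∈ l, ‖x - 1‖ ≤ b) →
      ‖l.prod - 1 - (l.map (· - 1)).sum‖ ≤ (1 + b) ^ l.length - 1 - l.length * b
  | [], _ => by simp
  | x :: l, h => by
    have hx : ‖x - 1‖ ≤ b := h x (by simp)
    have h' : ∀ y ∈ l, ‖y - 1‖ ≤ b := fun y hy => h y (by simp [hy])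
    have ih := norm_prod_sub_one_sub_sum_le b hb l h'
    have ih₁ := norm_prod_sub_one_le b hb l h'
    have hP : 0 ≤ (1 + b) ^ l.length - 1 := by
      have : (1 : ℝ) ≤ (1 + b) ^ l.length := one_le_pow₀ (by linarith)
      linarith
    rw [List.prod_cons, List.length_cons, List.map_cons, List.sum_cons]
    have e : x * l.prod - 1 - ((x - 1) + (l.map (· - 1)).sum) =
        (x - 1) * (l.prod - 1) + (l.prod - 1 - (l.map (· - 1)).sum) := by noncomm_ring
    rw [e]
    calc ‖(x - 1) * (l.prod - 1) + (l.prod - 1 - (l.map (· - 1)).sum)‖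
        ≤ ‖x - 1‖ * ‖l.prod - 1‖ + ‖l.prod - 1 - (l.map (· - 1)).sum‖ :=
          (norm_add_le _ _).trans (add_le_add (norm_mul_le _ _) le_rfl)
      _ ≤ b * ((1 + b) ^ l.length - 1) + ((1 + b) ^ l.length - 1 - l.length * b) := by gcongr
      _ = (1 + b) ^ (l.length + 1) - 1 - ((l.length + 1 : ℕ) : ℝ) * b := by push_cast; ring

/-- Five factors: `‖x₁x₂x₃x₄x₅ − 1 − Σ(xᵢ − 1)‖ ≤ 26b²` when every `‖xᵢ − 1‖ ≤ b ≤ 1`. [folklore] -/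
private theorem norm_prod_five_sub_le {x₁ x₂ x₃ x₄ x₅ : 𝔸} {b : ℝ} (hb : 0 ≤ b) (hb1 : b ≤ 1)
    (h₁ : ‖x₁ - 1‖ ≤ b) (h₂ : ‖x₂ - 1‖ ≤ b) (h₃ : ‖x₃ - 1‖ ≤ b) (h₄ : ‖x₄ - 1‖ ≤ b) (h₅ : ‖x₅ - 1‖ ≤ b) :
    ‖x₁ * x₂ * x₃ * x₄ * x₅ - 1 - ((x₁ - 1) + (x₂ - 1) + (x₃ - 1) + (x₄ - 1) + (x₅ - 1))‖ ≤ 26 * b ^ 2 := by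
  have h := norm_prod_sub_one_sub_sum_le b hb [x₁, x₂, x₃, x₄, x₅] (by simp [h₁, h₂, h₃, h₄, h₅])
  simp only [List.prod_cons, List.prod_nil, mul_one, List.map_cons, List.map_nil, List.sum_cons, List.sum_nil,
    add_zero, List.length_cons, List.length_nil] at h
  have e : (1 + b) ^ (0 + 1 + 1 + 1 + 1 + 1) - 1 - ((0 + 1 + 1 + 1 + 1 + 1 : ℕ) : ℝ) * b
      = b ^ 2 * (10 + 10 * b + 5 * b ^ 2 + b ^ 3) := by push_cast; ring
  rw [e] at h
  have hb' : b ^ 2 * (10 + 10 * b + 5 * b ^ 2 + b ^ 3) ≤ 26 * b ^ 2 := by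
    have h26 : 10 + 10 * b + 5 * b ^ 2 + b ^ 3 ≤ 26 := by nlinarith [sq_nonneg b, mul_nonneg hb (sq_nonneg b)]
    nlinarith [sq_nonneg b]
  simpa [mul_assoc, add_assoc] using h.trans hb'

/-- Four factors: `‖x₁x₂x₃x₄ − 1 − Σ(xᵢ − 1)‖ ≤ 11b²` when every `‖xᵢ − 1‖ ≤ b ≤ 1`. [folklore] -/
private theorem norm_prod_four_sub_le {x₁ x₂ x₃ x₄ : 𝔸} {b : ℝ} (hb : 0 ≤ b) (hb1 : b ≤ 1)
    (h₁ : ‖x₁ - 1‖ ≤ b) (h₂ : ‖x₂ - 1‖ ≤ b) (h₃ : ‖x₃ - 1‖ ≤ b) (h₄ : ‖x₄ - 1‖ ≤ b) :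
    ‖x₁ * x₂ * x₃ * x₄ - 1 - ((x₁ - 1) + (x₂ - 1) + (x₃ - 1) + (x₄ - 1))‖ ≤ 11 * b ^ 2 := by
  have h := norm_prod_sub_one_sub_sum_le b hb [x₁, x₂, x₃, x₄] (by simp [h₁, h₂, h₃, h₄])
  simp only [List.prod_cons, List.prod_nil, mul_one, List.map_cons, List.map_nil, List.sum_cons, List.sum_nil,
    add_zero, List.length_cons, List.length_nil] at h
  have e : (1 + b) ^ (0 + 1 + 1 + 1 + 1) - 1 - ((0 + 1 + 1 + 1 + 1 : ℕ) : ℝ) * b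
      = b ^ 2 * (6 + 4 * b + b ^ 2) := by push_cast; ring
  rw [e] at h
  have hb' : b ^ 2 * (6 + 4 * b + b ^ 2) ≤ 11 * b ^ 2 := by
    have h11 : 6 + 4 * b + b ^ 2 ≤ 11 := by nlinarith [sq_nonneg b]
    nlinarith [sq_nonneg b]
  simpa [mul_assoc, add_assoc] using h.trans hb'

/-- **Commutator of near-`1` elements**: `‖z q w − q‖ ≤ 2‖z − 1‖·‖q − 1‖` when `z w = 1`, `‖w‖ ≤ 1`. [folklore] -/
private theorem norm_conj_sub_self_le {z w q : 𝔸} (hzw : z * w = 1) (hw : ‖w‖ ≤ 1) :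
    ‖z * q * w - q‖ ≤ 2 * ‖z - 1‖ * ‖q - 1‖ := by
  have e : z * q * w - q = ((z - 1) * (q - 1) - (q - 1) * (z - 1)) * w := by
    have h1 : z * q * w - q = z * q * w - q * (z * w) := by rw [hzw, mul_one]
    rw [h1]
    noncomm_ring
  rw [e]
  calc ‖((z - 1) * (q - 1) - (q - 1) * (z - 1)) * w‖ ≤ ‖(z - 1) * (q - 1) - (q - 1) * (z - 1)‖ * ‖w‖ := norm_mul_le _ _
    _ ≤ (‖z - 1‖ * ‖q - 1‖ + ‖q - 1‖ * ‖z - 1‖) * 1 := by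
        gcongr
        exact (norm_sub_le _ _).trans (add_le_add (norm_mul_le _ _) (norm_mul_le _ _))
    _ = 2 * ‖z - 1‖ * ‖q - 1‖ := by ring

/-- **An inverse pair to second order**: `‖(w − 1) + (q − 1)‖ ≤ ‖q − 1‖²` when `w q = 1`, `‖w‖ ≤ 1`
(`(w − 1) + (q − 1) = w(q − 1)²`). [folklore] -/
private theorem norm_inv_add_self_sub_two_le {w q : 𝔸} (hwq : w * q = 1) (hw : ‖w‖ ≤ 1) :
    ‖(w - 1) + (q - 1)‖ ≤ ‖q - 1‖ ^ 2 := by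
  have e : (w - 1) + (q - 1) = w * ((q - 1) * (q - 1)) := by
    have : w * ((q - 1) * (q - 1)) = (w * q) * q - 2 * (w * q) + w := by noncomm_ring
    rw [this, hwq]; noncomm_ring
  rw [e]
  calc ‖w * ((q - 1) * (q - 1))‖ ≤ ‖w‖ * (‖q - 1‖ * ‖q - 1‖) :=
        (norm_mul_le _ _).trans (mul_le_mul_of_nonneg_left (norm_mul_le _ _) (norm_nonneg _))
    _ ≤ 1 * (‖q - 1‖ * ‖q - 1‖) := by gcongr
    _ = ‖q - 1‖ ^ 2 := by ring

/-- **The key identity to second order**: if `Π = (z q′ w) P₀` with `z w = 1`, `q′ q = 1` and `‖w‖, ‖P₀‖, ‖q′‖ ≤ 1`, then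
`‖(Π − 1) + (q − 1) − (P₀ − 1)‖ ≤ 2‖z − 1‖‖q′ − 1‖ + ‖q′ − 1‖‖P₀ − 1‖ + ‖q − 1‖²`. [folklore] -/
private theorem norm_key_identity_le {z w q q' P₀ : 𝔸} (hzw : z * w = 1) (hw : ‖w‖ ≤ 1) (hq : q' * q = 1) (hq' : ‖q'‖ ≤ 1)
    (hP₀ : ‖P₀‖ ≤ 1) :
    ‖(z * q' * w * P₀ - 1) + (q - 1) - (P₀ - 1)‖ ≤
      2 * ‖z - 1‖ * ‖q' - 1‖ + ‖q' - 1‖ * ‖P₀ - 1‖ + ‖q - 1‖ ^ 2 := by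
  have e : (z * q' * w * P₀ - 1) + (q - 1) - (P₀ - 1) =
      (z * q' * w - q') * P₀ + (q' - 1) * (P₀ - 1) + ((q' - 1) + (q - 1)) := by noncomm_ring
  rw [e]
  calc ‖(z * q' * w - q') * P₀ + (q' - 1) * (P₀ - 1) + ((q' - 1) + (q - 1))‖
      ≤ ‖(z * q' * w - q') * P₀‖ + ‖(q' - 1) * (P₀ - 1)‖ + ‖(q' - 1) + (q - 1)‖ :=
        (norm_add_le _ _).trans (add_le_add (norm_add_le _ _) le_rfl)
    _ ≤ (2 * ‖z - 1‖ * ‖q' - 1‖) * 1 + ‖q' - 1‖ * ‖P₀ - 1‖ + ‖q - 1‖ ^ 2 := by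
        gcongr
        · exact (norm_mul_le _ _).trans (mul_le_mul (norm_conj_sub_self_le hzw hw) hP₀ (norm_nonneg _)
            (by positivity))
        · exact norm_mul_le _ _
        · exact norm_inv_add_self_sub_two_le hq hq'
    _ = _ := by ring

end Algebra

/-! ## §1b The printed operation `exp[mean log]` to second order -/

section Eml

open ExpMeanLog MatrixLog B7BlockAvgLog FederbushMean NormedSpace

variable {𝔸 : Type*} [NormedRing 𝔸] [NormedAlgebra ℂ 𝔸] [CompleteSpace 𝔸] {ι : Type*} [Fintype ι]

omit [CompleteSpace 𝔸] in
/-- The mean of a family bounded by `B` in norm has norm `≤ B`. [folklore] -/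
private theorem norm_mean_le [Nonempty ι] {m : ι → 𝔸} {B : ℝ} (h : ∀ i, ‖m i‖ ≤ B) :
    ‖((Fintype.card ι : ℂ))⁻¹ • ∑ i, m i‖ ≤ B := by
  have hc : (0 : ℝ) < Fintype.card ι := Nat.cast_pos.mpr Fintype.card_pos
  have hsum : ∑ i, ‖m i‖ ≤ ∑ _i : ι, B := Finset.sum_le_sum fun i _ => h i
  rw [Finset.sum_const, Finset.card_univ, nsmul_eq_mul] at hsum
  rw [norm_smul, norm_inv, Complex.norm_natCast, inv_mul_le_iff₀ hc]
  exact (norm_sum_le _ _).trans hsum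

/-- **`exp[mean log]` TO SECOND ORDER**: if every `‖Wᵢ − 1‖ ≤ t ≤ ¼` (nonempty family), then
`‖eml W − 1 − |I|⁻¹ Σᵢ (Wᵢ − 1)‖ ≤ 6t²` ((21) `‖log W − (W − 1)‖ ≤ (4/3)‖W − 1‖²`, `‖e^B − 1 − B‖ ≤ ‖B‖²` with
`‖B‖ ≤ 2t`). [cite: Balaban1985Averaging, (26)-(27) p.22] -/
theorem norm_eml_sub_one_sub_mean_le [Nonempty ι] {W : ι → 𝔸} {t : ℝ} (hW : ∀ i, ‖W i - 1‖ ≤ t) (ht : t ≤ 1 / 4) :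
    ‖eml W - 1 - ((Fintype.card ι : ℂ))⁻¹ • ∑ i, (W i - 1)‖ ≤ 6 * t ^ 2 := by
  have h0 : 0 ≤ t := (norm_nonneg _).trans (hW (Classical.arbitrary ι))
  set B : 𝔸 := ((Fintype.card ι : ℂ))⁻¹ • ∑ i, mlog (W i) with hB
  have hBn : ‖B‖ ≤ 2 * t := norm_mean_le fun i =>
    (norm_mlog_le_two_mul ((hW i).trans (ht.trans (by norm_num)))).trans (by linarith [hW i])
  have hB1 : ‖B‖ ≤ 1 := hBn.trans (by linarith)
  have hexp : ‖exp B - 1 - B‖ ≤ ‖B‖ ^ 2 := OneLinkLaplace.norm_exp_sub_one_sub_le_sq hB1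
  have hlog : ∀ i, ‖mlog (W i) - (W i - 1)‖ ≤ (4 / 3) * t ^ 2 := by
    intro i
    have h1 : ‖W i - 1‖ < 1 := (hW i).trans_lt (ht.trans_lt (by norm_num))
    refine (norm_mlog_sub_sub_one_le h1).trans ?_
    have hden : 3 / 4 ≤ 1 - ‖W i - 1‖ := by linarith [hW i]
    have : ‖W i - 1‖ / (1 - ‖W i - 1‖) ≤ t / (3 / 4) :=
      div_le_div₀ h0 (hW i) (by norm_num) hden
    calc ‖W i - 1‖ / (1 - ‖W i - 1‖) * ‖W i - 1‖ ≤ t / (3 / 4) * t := by gcongr; exact hW i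
      _ = 4 / 3 * t ^ 2 := by ring
  have hdiff : ‖B - ((Fintype.card ι : ℂ))⁻¹ • ∑ i, (W i - 1)‖ ≤ (4 / 3) * t ^ 2 := by
    rw [hB, ← smul_sub, ← Finset.sum_sub_distrib]
    exact norm_mean_le hlog
  rw [eml_eq_exp]
  have e : exp B - 1 - ((Fintype.card ι : ℂ))⁻¹ • ∑ i, (W i - 1) =
      (exp B - 1 - B) + (B - ((Fintype.card ι : ℂ))⁻¹ • ∑ i, (W i - 1)) := by abel
  rw [e]
  calc ‖(exp B - 1 - B) + (B - ((Fintype.card ι : ℂ))⁻¹ • ∑ i, (W i - 1))‖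
      ≤ ‖B‖ ^ 2 + (4 / 3) * t ^ 2 := (norm_add_le _ _).trans (add_le_add hexp hdiff)
    _ ≤ (2 * t) ^ 2 + (4 / 3) * t ^ 2 := by gcongr
    _ ≤ 6 * t ^ 2 := by nlinarith [sq_nonneg t]

omit [CompleteSpace 𝔸] in
/-- `eml` is invariant under reindexing along ANY equivalence of finite index types (a finite sum reindexed; the weights
`|I|⁻¹` agree since the cardinalities do). [cite: Balaban1987RG1, (0.7) p.253] -/
theorem eml_comp_equiv' {κ : Type*} [Fintype κ] (W : ι → 𝔸) (e : κ ≃ ι) : eml (W ∘ e) = eml W := by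
  rw [eml_eq_exp, eml_eq_exp, Fintype.card_congr e]
  congr 2
  exact Fintype.sum_equiv e _ _ fun _ => rfl

end Eml

/-! ## §2 Torus bookkeeping: straight walks, staircases, the (0.4) loop variable factorised -/

section Words

open T4Continuum BlockAveraging AveragingRT B10Eq47AxialChi LatticeWordStokes

variable {P : Params} {j : ℕ}

/-- Coordinates of the `m`-fold shift: `(x + m e_μ)_κ = x_κ + m·[κ = μ]`. [cite: Balaban1984PropagatorsI, (1.7) p.18 (bookkeeping)] -/
theorem shiftN_apply (x : Site P j) (μ : Fin P.d) : ∀ (m : ℕ) (κ : Fin P.d),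
    shiftN x μ m κ = x κ + (if κ = μ then ((m : ℕ) : ZMod (P.sitesPerDir j)) else 0)
  | 0, κ => by simp
  | m + 1, κ => by
    rw [shiftN_succ, Site.shift_apply, shiftN_apply x μ m μ, shiftN_apply x μ m κ]
    by_cases h : κ = μ
    · subst h; simp only [if_true]; push_cast; ring
    · simp [h]

/-- The straight walk of `m` steps `+e_μ` from `x` ends at `x + m e_μ`. [cite: Balaban1984PropagatorsI, (1.7) p.18 (bookkeeping)] -/
theorem walkEnd_replicate_true (x : Site P j) (μ : Fin P.d) (m : ℕ) :
    walkEnd x (List.replicate m (μ, true)) = shiftN x μ m := by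
  funext κ
  rw [walkEnd_apply, T4ReflectionCone.netDisp_replicate, shiftN_apply]
  by_cases h : κ = μ
  · subst h; simp
  · simp [h, Ne.symm h]

variable {G : Type*} [GaugeGroup G]

/-- The holonomy of the straight walk of `m` steps `+e_μ` from `x` is the straight product `rowProd U x μ m` of
`B10Eq47AxialChi` ((9) p. 19 along a straight contour). [cite: Balaban1985Averaging, (9) p.19] -/
theorem holAt_walk_replicate_true (U : GaugeField P j G) (x : Site P j) (μ : Fin P.d) :
    ∀ m : ℕ, holAt U (walk x (List.replicate m (μ, true))) = rowProd U x μ m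
  | 0 => by simp [walk, holAt_nil]
  | m + 1 => by
    rw [List.replicate_succ', walk_append, holAt_append, holAt_walk_replicate_true U x μ m, walkEnd_replicate_true,
      rowProd_succ]
    simp [walk, holAt_cons, holAt_nil]

/-- Coordinates of the end of a staircase: `walkEnd x Γ^σ(n) = x + n`. [cite: Balaban1987RG1, (0.3) p.252 (bookkeeping)] -/
theorem walkEnd_stairWord_apply (x : Site P j) (σ : Equiv.Perm (Fin P.d)) (n : Fin P.d → ℤ) (κ : Fin P.d) :
    walkEnd x (stairWord σ n) κ = x κ + ((n κ : ℤ) : ZMod (P.sitesPerDir j)) := by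
  rw [walkEnd_apply, netDisp_stairWord]

/-- The end of a staircase does not depend on the ordering of its runs. [cite: Balaban1987RG1, (0.3) p.252 (bookkeeping)] -/
theorem walkEnd_stairWord_eq (x : Site P j) (σ σ' : Equiv.Perm (Fin P.d)) (n : Fin P.d → ℤ) :
    walkEnd x (stairWord σ n) = walkEnd x (stairWord σ' n) := by
  funext κ; rw [walkEnd_stairWord_apply, walkEnd_stairWord_apply]

/-- Unit shifts in two directions commute on the torus (coarse sites). [cite: Balaban1987RG1, (0.1) p.252 (bookkeeping)] -/
theorem shift_shift_comm {i : ℕ} (y : Site P i) (μ ν : Fin P.d) : (y.shift μ).shift ν = (y.shift ν).shift μ := by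
  funext κ
  simp only [Site.shift_apply]
  by_cases hν : κ = ν <;> by_cases hμ : κ = μ
  · subst hν; subst hμ; simp
  · subst hν; simp [hμ]
  · subst hμ; simp [hν]
  · simp [hμ, hν]

/-- **The staircase from the NEXT block centre ends `L` fine steps further**: `walkEnd (emb (y + e_μ)) Γ^{σ′}(n) =
walkEnd (emb y) Γ^σ(n) + L e_μ`. [cite: Balaban1987RG1, (0.3) p.252] -/
theorem walkEnd_stairWord_shift (y : Site P (j + 1)) (μ : Fin P.d) (σ σ' : Equiv.Perm (Fin P.d)) (n : Fin P.d → ℤ) :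
    walkEnd (emb (y.shift μ)) (stairWord σ' n) = shiftN (walkEnd (emb y) (stairWord σ n)) μ P.L := by
  funext κ
  rw [walkEnd_stairWord_apply, shiftN_apply, walkEnd_stairWord_apply, emb_shift_apply]
  by_cases h : κ = μ
  · subst h; simp only [if_true]; ring
  · simp [h]

/-- The same, read with a straight walk: `walkEnd (walkEnd (emb y) Γ^σ(n)) (L steps +e_μ) = walkEnd (emb (y+e_μ)) Γ^{σ′}(n)`. [cite: Balaban1987RG1, (0.3)–(0.4) pp.252–253 (bookkeeping)] -/
theorem walkEnd_stairWord_replicate (y : Site P (j + 1)) (μ : Fin P.d) (σ σ' : Equiv.Perm (Fin P.d)) (n : Fin P.d → ℤ) :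
    walkEnd (walkEnd (emb y) (stairWord σ n)) (List.replicate P.L (μ, true)) = walkEnd (emb (y.shift μ)) (stairWord σ' n) := by
  rw [walkEnd_replicate_true, walkEnd_stairWord_shift y μ σ σ' n]

/-- `(−c)`: the straight walk of `L` steps `−e_μ` from `emb c₊` has holonomy `U(c)⁻¹` (`U(c)` = `axialAvg U c`). [cite: Balaban1987RG1, (0.4) p.253] -/
theorem holAt_walk_replicate_false_tgt (U : GaugeField P j G) (c : PBond P (j + 1)) :
    holAt U (walk (emb c.tgt) (List.replicate P.L (c.dir, false))) = (axialAvg U c)⁻¹ := by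
  have h1 : List.replicate P.L (c.dir, false) = wordRev (List.replicate P.L (c.dir, true)) := by
    rw [wordRev_replicate]; rfl
  rw [h1, show emb c.tgt = walkEnd (emb c.src) (List.replicate P.L (c.dir, true)) from (walkEnd_replicate_L c.src c.dir).symm,
    holAt_walk_wordRev, axialAvg_eq_holAt_walk]

/-- **THE (0.4) LOOP VARIABLE FACTORISED**: `U(Γ ∪ [x,x′] ∪ (−Γ′) ∪ (−c)) = U(Γ^σ_{c₋→x}) · U([x, x′]) · U(Γ^{σ′}_{c₊→x′})⁻¹ · U(c)⁻¹`
(holonomies of the four segments; `x = walkEnd (emb c₋) Γ^σ(n)`, `x′ = x + L e_μ`). [cite: Balaban1987RG1, (0.4) p.253] -/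
theorem loopHol_eq (U : GaugeField P j G) (c : PBond P (j + 1)) (i : Idx P) :
    loopHol U c i = holAt U (walk (emb c.src) (stairWord i.2.1 (off i.1))) *
      holAt U (walk (walkEnd (emb c.src) (stairWord i.2.1 (off i.1))) (List.replicate P.L (c.dir, true))) *
      (holAt U (walk (emb c.tgt) (stairWord i.2.2 (off i.1))))⁻¹ * (axialAvg U c)⁻¹ := by
  unfold loopHol loopWord
  rw [walk_append, holAt_append, walk_append, holAt_append, walk_append, holAt_append,
    walkEnd_stairWord_replicate c.src c.dir i.2.1 i.2.2 (off i.1)]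
  rw [show c.src.shift c.dir = c.tgt from rfl, holAt_walk_wordRev, walkEnd_walkEnd_wordRev, holAt_walk_replicate_false_tgt]
  simp only [mul_assoc]

/-- A coarse plaquette variable of `Ū = avgFun ℰ U` REARRANGED: with `c₁ = ⟨y, μ⟩`, `c₂ = ⟨y+e_μ, ν⟩`, `c₃ = ⟨y+e_ν, μ⟩`,
`c₄ = ⟨y, ν⟩`, `S_i = U(c_i)` and the correction factors `κ_i = corr ℰ U c_i`:
`Ū(∂p′) = κ₁ · (S₁κ₂S₁⁻¹) · (S₁S₂S₃⁻¹S₄⁻¹) · (S₄κ₃⁻¹S₄⁻¹) · κ₄⁻¹` (group identity). [cite: Balaban1987RG1, (0.4) p.253] -/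
theorem plaqHol_avgFun_eq_five (ℰ : LoopAverage G) (U : GaugeField P j G) (p : Plaq P (j + 1)) :
    GaugeField.plaqHol (avgFun ℰ U) p =
      corr ℰ U ⟨p.src, p.μ⟩ *
      (axialAvg U ⟨p.src, p.μ⟩ * corr ℰ U ⟨p.src.shift p.μ, p.ν⟩ * (axialAvg U ⟨p.src, p.μ⟩)⁻¹) *
      (axialAvg U ⟨p.src, p.μ⟩ * axialAvg U ⟨p.src.shift p.μ, p.ν⟩ * (axialAvg U ⟨p.src.shift p.ν, p.μ⟩)⁻¹ *
        (axialAvg U ⟨p.src, p.ν⟩)⁻¹) *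
      (axialAvg U ⟨p.src, p.ν⟩ * (corr ℰ U ⟨p.src.shift p.ν, p.μ⟩)⁻¹ * (axialAvg U ⟨p.src, p.ν⟩)⁻¹) *
      (corr ℰ U ⟨p.src, p.ν⟩)⁻¹ := by
  simp only [GaugeField.plaqHol, avgFun]
  group

/-- The straight transporters' coarse plaquette IS `plaqHol (axialAvg U) p′` (definitional). [cite: Balaban1985Averaging, (9) p.19] -/
theorem plaqHol_axialAvg_eq (U : GaugeField P j G) (p : Plaq P (j + 1)) :
    GaugeField.plaqHol (axialAvg U) p = axialAvg U ⟨p.src, p.μ⟩ * axialAvg U ⟨p.src.shift p.μ, p.ν⟩ *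
      (axialAvg U ⟨p.src.shift p.ν, p.μ⟩)⁻¹ * (axialAvg U ⟨p.src, p.ν⟩)⁻¹ := rfl

/-- **EXACT LATTICE STOKES FOR A TRANSLATED COARSE SQUARE, UNIFORM FORM**: if every plaquette variable of `U` is within `δ` of `1`,
the boundary holonomy of the `L × L` square based at ANY fine site `x` is within `L²δ` of `1`. [cite: Balaban1985Averaging, (19) p.21] -/
theorem dist1_rect_LL_le (U : GaugeField P j G) {δ : ℝ} (hU : ∀ q : Plaq P j, dist1 (GaugeField.plaqHol U q) ≤ δ)
    (x : Site P j) {μ ν : Fin P.d} (h : μ < ν) : dist1 (rect U x μ ν P.L P.L) ≤ (P.L : ℝ) ^ 2 * δ := by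
  refine (dist1_rect_le U x h P.L P.L).trans ?_
  calc ∑ t ∈ Finset.range P.L, ∑ s ∈ Finset.range P.L, dist1 (GaugeField.plaqHol U ⟨shiftN (shiftN x ν t) μ s, μ, ν, h⟩)
      ≤ ∑ _t ∈ Finset.range P.L, ∑ _s ∈ Finset.range P.L, δ :=
        Finset.sum_le_sum fun t _ => Finset.sum_le_sum fun s _ => hU _
    _ = (P.L : ℝ) ^ 2 * δ := by simp [Finset.sum_const, Finset.card_range]; ring

/-- The per-index CLOSED WORD `Γ^σ(n) ++ (L·e_μ) ++ (L·e_ν) ++ rev Γ^ρ(n) ++ (L·(−e_ν)) ++ (L·(−e_μ))` (the transport `c₋ → x → x+Le_μ →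
x+Le_μ+Le_ν → emb(c₋+e_μ+e_ν)` followed by the two straight coarse bonds back) has zero net displacement. [cite: Balaban1987RG1, (0.3)–(0.4) pp.252–253 (bookkeeping)] -/
theorem netDisp_zWord (μ ν : Fin P.d) (σ ρ : Equiv.Perm (Fin P.d)) (n : Fin P.d → ℤ) (κ : Fin P.d) :
    netDisp (stairWord σ n ++ (List.replicate P.L (μ, true) ++ (List.replicate P.L (ν, true) ++
      (wordRev (stairWord ρ n) ++ (List.replicate P.L (ν, false) ++ List.replicate P.L (μ, false)))))) κ = 0 := by
  simp only [T4ReflectionCone.netDisp_append, T4ReflectionCone.netDisp_replicate, netDisp_stairWord, netDisp_wordRev]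
  by_cases hμ : μ = κ
  · by_cases hν : ν = κ
    · simp [hμ, hν]; ring
    · simp [hμ, hν]
  · by_cases hν : ν = κ
    · simp [hμ, hν]
    · simp [hμ, hν]

/-- A reversed word has the same length. [folklore] -/
private theorem length_wordRev' {d : ℕ} (w : List (Letter d)) : (wordRev w).length = w.length := by
  simp [wordRev]

/-- The closed word of `netDisp_zWord` has length `≤ (d + 4)·L` (`|Γ^σ(n)| ≤ d(L−1)/2`, `|n_κ| ≤ (L−1)/2`). [cite: Balaban1987RG1, (0.3) p.252 (bookkeeping)] -/
theorem length_zWord_le (μ ν : Fin P.d) (σ ρ : Equiv.Perm (Fin P.d)) (r : Fin P.d → Fin P.L) :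
    (stairWord σ (off r) ++ (List.replicate P.L (μ, true) ++ (List.replicate P.L (ν, true) ++
      (wordRev (stairWord ρ (off r)) ++ (List.replicate P.L (ν, false) ++ List.replicate P.L (μ, false)))))).length
      ≤ (P.d + 4) * P.L := by
  have hn : ∀ κ, (off r κ).natAbs ≤ (P.L - 1) / 2 := fun κ => by
    have h := off_bounds r κ
    omega
  have h1 := length_stairWord_le σ (off r) _ hn
  have h2 := length_stairWord_le ρ (off r) _ hn
  have hL := two_mul_half_add_one P
  simp only [List.length_append, List.length_replicate, length_wordRev']
  have h3 : P.d * ((P.L - 1) / 2) + P.d * ((P.L - 1) / 2) ≤ P.d * P.L := by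
    rw [← Nat.mul_add]; exact Nat.mul_le_mul_left _ (by omega)
  nlinarith

/-- **THE PER-INDEX TRANSPORT LOOP `Z`** as a product: the holonomy from `emb y` of the closed word of `netDisp_zWord` equals
`U(Γ^σ_{y→x}) · U([x, x+Le_μ]) · U([x+Le_μ, x+Le_μ+Le_ν]) · U(Γ^ρ_{y+e_μ+e_ν → x+Le_μ+Le_ν})⁻¹ · U(⟨y+e_μ, ν⟩)⁻¹ · U(⟨y, μ⟩)⁻¹`.
[cite: Balaban1987RG1, (0.3)–(0.4) pp.252–253] -/
theorem holAt_zWord_eq (U : GaugeField P j G) (y : Site P (j + 1)) (μ ν : Fin P.d) (σ τ ρ : Equiv.Perm (Fin P.d))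
    (n : Fin P.d → ℤ) :
    holAt U (walk (emb y) (stairWord σ n ++ (List.replicate P.L (μ, true) ++ (List.replicate P.L (ν, true) ++
      (wordRev (stairWord ρ n) ++ (List.replicate P.L (ν, false) ++ List.replicate P.L (μ, false))))))) =
    holAt U (walk (emb y) (stairWord σ n)) *
      holAt U (walk (walkEnd (emb y) (stairWord σ n)) (List.replicate P.L (μ, true))) *
      holAt U (walk (walkEnd (emb (y.shift μ)) (stairWord τ n)) (List.replicate P.L (ν, true))) *
      (holAt U (walk (emb ((y.shift μ).shift ν)) (stairWord ρ n)))⁻¹ *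
      (axialAvg U ⟨y.shift μ, ν⟩)⁻¹ * (axialAvg U ⟨y, μ⟩)⁻¹ := by
  rw [walk_append, holAt_append, walk_append, holAt_append, walk_append, holAt_append, walk_append, holAt_append,
    walk_append, holAt_append, walkEnd_stairWord_replicate y μ σ τ n, walkEnd_stairWord_replicate (y.shift μ) ν τ ρ n,
    holAt_walk_wordRev, walkEnd_walkEnd_wordRev]
  have h3 : (y.shift μ).shift ν = PBond.tgt ⟨y.shift μ, ν⟩ := rfl
  rw [h3, holAt_walk_replicate_false_tgt]
  have h4 : walkEnd (emb (PBond.tgt ⟨y.shift μ, ν⟩)) (List.replicate P.L (ν, false)) = emb (PBond.tgt ⟨y, μ⟩) := by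
    have e1 : List.replicate P.L (ν, false) = wordRev (List.replicate P.L (ν, true)) := by rw [wordRev_replicate]; rfl
    rw [e1, show PBond.tgt (⟨y.shift μ, ν⟩ : PBond P (j + 1)) = (y.shift μ).shift ν from rfl, ← walkEnd_replicate_L,
      walkEnd_walkEnd_wordRev]; rfl
  rw [h4, holAt_walk_replicate_false_tgt]
  simp only [mul_assoc]

end Words

/-! ## §3 Coupling the four index families of a coarse plaquette: reindexing identities -/

section Reindex

variable {R S 𝕄 : Type*} [Fintype R] [Fintype S] [AddCommGroup 𝕄]

/-- Summing a function of `(r, σ, τ)` over `(r, σ, τ, ρ, ω)` multiplies it by `|S|²`. [folklore] -/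
private theorem sum_couple₁₂ (g : R × S × S → 𝕄) :
    ∑ J : R × S × S × S × S, g (J.1, J.2.1, J.2.2.1) = (Fintype.card S * Fintype.card S) • ∑ i : R × S × S, g i := by
  simp only [Fintype.sum_prod_type, Finset.sum_const, Finset.card_univ, Finset.smul_sum, Fintype.card_prod]

/-- Summing a function of `(r, τ, ρ)` over `(r, σ, τ, ρ, ω)` multiplies it by `|S|²`. [folklore] -/
private theorem sum_couple₂₃ (g : R × S × S → 𝕄) :
    ∑ J : R × S × S × S × S, g (J.1, J.2.2.1, J.2.2.2.1) = (Fintype.card S * Fintype.card S) • ∑ i : R × S × S, g i := by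
  simp only [Fintype.sum_prod_type, Finset.sum_const, Finset.card_univ, Finset.smul_sum, smul_smul]

/-- Summing a function of `(r, ω, ρ)` over `(r, σ, τ, ρ, ω)` multiplies it by `|S|²`. [folklore] -/
private theorem sum_couple₅₄ (g : R × S × S → 𝕄) :
    ∑ J : R × S × S × S × S, g (J.1, J.2.2.2.2, J.2.2.2.1) = (Fintype.card S * Fintype.card S) • ∑ i : R × S × S, g i := by
  simp only [Fintype.sum_prod_type, Finset.sum_const, Finset.card_univ, Finset.smul_sum, smul_smul]
  refine Finset.sum_congr rfl fun r _ => ?_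
  rw [Finset.sum_comm]

/-- Summing a function of `(r, σ, ω)` over `(r, σ, τ, ρ, ω)` multiplies it by `|S|²`. [folklore] -/
private theorem sum_couple₁₅ (g : R × S × S → 𝕄) :
    ∑ J : R × S × S × S × S, g (J.1, J.2.1, J.2.2.2.2) = (Fintype.card S * Fintype.card S) • ∑ i : R × S × S, g i := by
  simp only [Fintype.sum_prod_type, Finset.sum_const, Finset.card_univ, Finset.smul_sum, smul_smul]

variable [Module ℂ 𝕄] [Nonempty R] [Nonempty S]

/-- The normalisation: `|R × S⁴|⁻¹ · |S|² = |R × S²|⁻¹`. [folklore] -/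
private theorem card_couple_smul (X : 𝕄) :
    ((Fintype.card (R × S × S × S × S) : ℂ))⁻¹ • ((Fintype.card S * Fintype.card S) • X) =
      ((Fintype.card (R × S × S) : ℂ))⁻¹ • X := by
  have hR : (Fintype.card R : ℂ) ≠ 0 := Nat.cast_ne_zero.mpr Fintype.card_ne_zero
  have hS : (Fintype.card S : ℂ) ≠ 0 := Nat.cast_ne_zero.mpr Fintype.card_ne_zero
  rw [← Nat.cast_smul_eq_nsmul ℂ, smul_smul]
  congr 1
  simp only [Fintype.card_prod, Nat.cast_mul]
  field_simp

/-- **MEAN OVER THE COUPLED INDEX = MEAN OVER THE BOND's OWN INDEX**, pattern `(r, σ, τ)`. [cite: Balaban1987RG1, (0.4) p.253 (bookkeeping: the printed weights' marginals)] -/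
theorem mean_couple₁₂ (g : R × S × S → 𝕄) :
    ((Fintype.card (R × S × S × S × S) : ℂ))⁻¹ • ∑ J : R × S × S × S × S, g (J.1, J.2.1, J.2.2.1) =
      ((Fintype.card (R × S × S) : ℂ))⁻¹ • ∑ i : R × S × S, g i := by
  rw [sum_couple₁₂, card_couple_smul]

/-- The same, pattern `(r, τ, ρ)`. [cite: Balaban1987RG1, (0.4) p.253 (bookkeeping)] -/
theorem mean_couple₂₃ (g : R × S × S → 𝕄) :
    ((Fintype.card (R × S × S × S × S) : ℂ))⁻¹ • ∑ J : R × S × S × S × S, g (J.1, J.2.2.1, J.2.2.2.1) =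
      ((Fintype.card (R × S × S) : ℂ))⁻¹ • ∑ i : R × S × S, g i := by
  rw [sum_couple₂₃, card_couple_smul]

/-- The same, pattern `(r, ω, ρ)`. [cite: Balaban1987RG1, (0.4) p.253 (bookkeeping)] -/
theorem mean_couple₅₄ (g : R × S × S → 𝕄) :
    ((Fintype.card (R × S × S × S × S) : ℂ))⁻¹ • ∑ J : R × S × S × S × S, g (J.1, J.2.2.2.2, J.2.2.2.1) =
      ((Fintype.card (R × S × S) : ℂ))⁻¹ • ∑ i : R × S × S, g i := by
  rw [sum_couple₅₄, card_couple_smul]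

/-- The same, pattern `(r, σ, ω)`. [cite: Balaban1987RG1, (0.4) p.253 (bookkeeping)] -/
theorem mean_couple₁₅ (g : R × S × S → 𝕄) :
    ((Fintype.card (R × S × S × S × S) : ℂ))⁻¹ • ∑ J : R × S × S × S × S, g (J.1, J.2.1, J.2.2.2.2) =
      ((Fintype.card (R × S × S) : ℂ))⁻¹ • ∑ i : R × S × S, g i := by
  rw [sum_couple₁₅, card_couple_smul]

end Reindex

/-! ## §4 `SU(N)`: the correction factors to second order -/

section SUN

open T4Continuum BlockAveraging AveragingRT ExpMeanLog LatticeWordStokes B10Eq47AxialChi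
open scoped Matrix.Norms.L2Operator

variable {n : Type*} [Fintype n] [DecidableEq n] [Nonempty n] {P : Params} {j : ℕ}

omit [Nonempty n] in
/-- Elements of `SU(N)` are unitary matrices. [folklore] -/
private theorem coe_mem_unitaryGroup (g : Matrix.specialUnitaryGroup n ℂ) : (g : Matrix n n ℂ) ∈ Matrix.unitaryGroup n ℂ :=
  (Matrix.mem_specialUnitaryGroup_iff.1 g.2).1

omit [Nonempty n] in
/-- `g · g* = 1` for `g ∈ SU(N)`. [folklore] -/
private theorem coe_mul_star_self (g : Matrix.specialUnitaryGroup n ℂ) : (g : Matrix n n ℂ) * star (g : Matrix n n ℂ) = 1 :=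
  Unitary.mul_star_self_of_mem (coe_mem_unitaryGroup g)

omit [Nonempty n] in
/-- `g* · g = 1` for `g ∈ SU(N)`. [folklore] -/
private theorem coe_star_mul_self (g : Matrix.specialUnitaryGroup n ℂ) : star (g : Matrix n n ℂ) * (g : Matrix n n ℂ) = 1 :=
  Unitary.star_mul_self_of_mem (coe_mem_unitaryGroup g)

omit [Nonempty n] in
/-- The inverse in `SU(N)` is the conjugate transpose (coercion lemma). [folklore] -/
private theorem coe_inv_eq_star (g : Matrix.specialUnitaryGroup n ℂ) :
    ((g⁻¹ : Matrix.specialUnitaryGroup n ℂ) : Matrix n n ℂ) = star (g : Matrix n n ℂ) := rfl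

omit [Nonempty n] in
/-- `g*` is unitary for `g ∈ SU(N)`. [folklore] -/
private theorem star_coe_mem_unitaryGroup (g : Matrix.specialUnitaryGroup n ℂ) : star (g : Matrix n n ℂ) ∈ Matrix.unitaryGroup n ℂ :=
  coe_mem_unitaryGroup g⁻¹

/-- `‖g‖ = 1` (operator norm) for `g ∈ SU(N)`. [folklore] -/
private theorem norm_coe_eq_one (g : Matrix.specialUnitaryGroup n ℂ) : ‖(g : Matrix n n ℂ)‖ = 1 :=
  CStarRing.norm_of_mem_unitary (coe_mem_unitaryGroup g)

omit [Nonempty n] in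
/-- Unitary conjugation preserves the operator norm: `‖g X g*‖ = ‖X‖`. [folklore] -/
private theorem norm_conj_eq (g : Matrix.specialUnitaryGroup n ℂ) (X : Matrix n n ℂ) :
    ‖(g : Matrix n n ℂ) * X * star (g : Matrix n n ℂ)‖ = ‖X‖ := by
  rw [← coe_inv_eq_star, CStarRing.norm_mul_mem_unitary _ (coe_mem_unitaryGroup g⁻¹),
    CStarRing.norm_mem_unitary_mul _ (coe_mem_unitaryGroup g)]

/-- **THE GUARDED AVERAGE IS `exp[mean log]` OVER THE INDEX TYPE ITSELF** (the fixed enumeration of `LoopAverage.avg` removed by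
`eml_comp_equiv'`). [cite: Balaban1987RG1, (0.4) and (0.7) p.253] -/
theorem coe_avg_eq_eml {ι : Type*} [Fintype ι] [Nonempty ι] (W : ι → Matrix.specialUnitaryGroup n ℂ)
    (hW : ∀ i, dist1 (W i) < deltaSU n) :
    (((expMeanLogSU (n := n)).avg W : Matrix.specialUnitaryGroup n ℂ) : Matrix n n ℂ) = eml fun i => (W i : Matrix n n ℂ) := by
  unfold LoopAverage.avg
  show ((ESU (W ∘ (LoopAverage.enum ι).symm) : Matrix.specialUnitaryGroup n ℂ) : Matrix n n ℂ) = _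
  have h : ∀ k, ‖(((W ∘ (LoopAverage.enum ι).symm) k : Matrix.specialUnitaryGroup n ℂ) : Matrix n n ℂ) - 1‖ < deltaSU n :=
    fun k => hW _
  rw [coe_ESU_of_small h]
  exact eml_comp_equiv' (fun i => (W i : Matrix n n ℂ)) (LoopAverage.enum ι).symm

/-- **THE CORRECTION FACTOR OF (0.4) TO SECOND ORDER**: if every loop variable at `c` satisfies `dist1 ≤ θ`, `θ < δ_N`, `θ ≤ ¼`, then
`‖κ_c − 1 − |I|⁻¹ Σᵢ (Wᵢ − 1)‖ ≤ 6θ²` (`κ_c = corr ℰp U c`, `Wᵢ = loopHol U c i`). [cite: Balaban1987RG1, (0.4) and (0.8) p.253] -/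
theorem norm_corr_sub_mean_le (U : GaugeField P j (Matrix.specialUnitaryGroup n ℂ)) (c : PBond P (j + 1)) {θ : ℝ}
    (hθ : ∀ i, dist1 (loopHol U c i) ≤ θ) (hθδ : θ < deltaSU n) (hθ4 : θ ≤ 1 / 4) :
    ‖((corr (expMeanLogSU (n := n)) U c : Matrix.specialUnitaryGroup n ℂ) : Matrix n n ℂ) - 1 -
        ((Fintype.card (Idx P) : ℂ))⁻¹ • ∑ i, (((loopHol U c i : Matrix.specialUnitaryGroup n ℂ) : Matrix n n ℂ) - 1)‖ ≤
      6 * θ ^ 2 := by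
  have hsmall : Small (expMeanLogSU (n := n)) U c := fun i => (hθ i).trans_lt hθδ
  unfold corr
  rw [if_pos hsmall, coe_avg_eq_eml _ hsmall]
  exact norm_eml_sub_one_sub_mean_le (fun i => hθ i) hθ4

/-- The same for the INVERSE correction factor: `κ_c⁻¹` is the average of the inverted loop variables ((0.5)), so
`‖κ_c⁻¹ − 1 − |I|⁻¹ Σᵢ (Wᵢ⁻¹ − 1)‖ ≤ 6θ²`. [cite: Balaban1987RG1, (0.4)–(0.5) p.253] -/
theorem norm_corr_inv_sub_mean_le (U : GaugeField P j (Matrix.specialUnitaryGroup n ℂ)) (c : PBond P (j + 1)) {θ : ℝ}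
    (hθ : ∀ i, dist1 (loopHol U c i) ≤ θ) (hθδ : θ < deltaSU n) (hθ4 : θ ≤ 1 / 4) :
    ‖(((corr (expMeanLogSU (n := n)) U c)⁻¹ : Matrix.specialUnitaryGroup n ℂ) : Matrix n n ℂ) - 1 -
        ((Fintype.card (Idx P) : ℂ))⁻¹ • ∑ i, ((((loopHol U c i)⁻¹ : Matrix.specialUnitaryGroup n ℂ) : Matrix n n ℂ) - 1)‖
      ≤ 6 * θ ^ 2 := by
  have hsmall : Small (expMeanLogSU (n := n)) U c := fun i => (hθ i).trans_lt hθδ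
  have hsmall' : ∀ i, dist1 ((loopHol U c i)⁻¹) < deltaSU n := fun i => by rw [GaugeGroup.dist1_inv]; exact hsmall i
  unfold corr
  rw [if_pos hsmall, ← (expMeanLogSU (n := n)).avg_inv _ hsmall, coe_avg_eq_eml _ hsmall']
  exact norm_eml_sub_one_sub_mean_le (fun i => by rw [← FederbushMean.dist1_SU_eq, GaugeGroup.dist1_inv]; exact hθ i) hθ4

end SUN

/-! ## §5 The coupled loop of a coarse plaquette: the first-order terms telescope -/

section Coupled

open T4Continuum BlockAveraging AveragingRT B10Eq47AxialChi LatticeWordStokes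

variable {P : Params} {j : ℕ} {G : Type*} [GaugeGroup G]

/-- The pure group identity behind the telescoping (free-group bookkeeping; all letters are atoms). [folklore] -/
private theorem key_group_identity {H : Type*} [Group H] (Tσ Tτ Tρ Tω B₁ B₂ B₃ B₄ S₁ S₂ S₃ S₄ : H) :
    (Tσ * B₁ * Tτ⁻¹ * S₁⁻¹) * (S₁ * (Tτ * B₂ * Tρ⁻¹ * S₂⁻¹) * S₁⁻¹) * (S₄ * (Tω * B₃ * Tρ⁻¹ * S₃⁻¹)⁻¹ * S₄⁻¹) *
        (Tσ * B₄ * Tω⁻¹ * S₄⁻¹)⁻¹ =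
      (Tσ * B₁ * B₂ * Tρ⁻¹ * S₂⁻¹ * S₁⁻¹) * (S₁ * S₂ * S₃⁻¹ * S₄⁻¹)⁻¹ * (Tσ * B₁ * B₂ * Tρ⁻¹ * S₂⁻¹ * S₁⁻¹)⁻¹ *
        (Tσ * (B₁ * B₂ * B₃⁻¹ * B₄⁻¹) * Tσ⁻¹) := by
  group

/-- `emb (y + e_μ) = emb y + L e_μ` as sites (no range hypothesis; coordinates by `emb_shift_apply`). [cite: Balaban1987RG1, (0.1) p.252] -/
theorem emb_shift_eq_shiftN (y : Site P (j + 1)) (μ : Fin P.d) : emb (y.shift μ) = shiftN (emb y) μ P.L := by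
  funext κ
  rw [emb_shift_apply, shiftN_apply]

/-- The coarse plaquette variable of the straight transporters is the `L × L` square holonomy based at `emb p′₋` (no range
hypothesis). [cite: Balaban1985Averaging, (9)–(10) p.19] -/
theorem plaqHol_axialAvg_eq_rect' (U : GaugeField P j G) (p : Plaq P (j + 1)) :
    GaugeField.plaqHol (axialAvg U) p = rect U (emb p.src) p.μ p.ν P.L P.L := by
  simp only [GaugeField.plaqHol, axialAvg_eq_holAt_walk, holAt_walk_replicate_true, rect, emb_shift_eq_shiftN]

/-- **THE COUPLED PRODUCT OF THE FOUR LOOP VARIABLES AROUND `∂p′`** (index `(r, σ, τ, ρ, ω)`: bond `c₁ = ⟨y, μ⟩` read at `(r, σ, τ)`,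
`c₂ = ⟨y+e_μ, ν⟩` at `(r, τ, ρ)` transported by `S₁ = U(c₁)`, `c₃ = ⟨y+e_ν, μ⟩` at `(r, ω, ρ)` inverted and transported by `S₄ = U(c₄)`,
`c₄ = ⟨y, ν⟩` at `(r, σ, ω)` inverted) EQUALS `Z · Q⁻¹ · Z⁻¹ · (T^σ · U(∂(p′)_x) · (T^σ)⁻¹)`: `Q` the straight coarse plaquette, `Z` the transport
loop of `holAt_zWord_eq`, `(p′)_x` the coarse square translated to `x = walkEnd (emb y) Γ^σ(n)`.  The staircases shared between consecutive
bonds CANCEL — this is where the symmetric definition (0.3) (one contour family PER BLOCK POINT, the same for both bonds at that point) enters.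
[cite: Balaban1987RG1, (0.3)–(0.4) pp.252–253] -/
theorem prod_four_loopHol_eq (U : GaugeField P j G) (y : Site P (j + 1)) {μ ν : Fin P.d} (hμν : μ < ν)
    (r : Fin P.d → Fin P.L) (σ τ ρ ω : Equiv.Perm (Fin P.d)) :
    loopHol U ⟨y, μ⟩ (r, σ, τ) *
      (axialAvg U ⟨y, μ⟩ * loopHol U ⟨y.shift μ, ν⟩ (r, τ, ρ) * (axialAvg U ⟨y, μ⟩)⁻¹) *
      (axialAvg U ⟨y, ν⟩ * (loopHol U ⟨y.shift ν, μ⟩ (r, ω, ρ))⁻¹ * (axialAvg U ⟨y, ν⟩)⁻¹) *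
      (loopHol U ⟨y, ν⟩ (r, σ, ω))⁻¹ =
    holAt U (walk (emb y) (stairWord σ (off r) ++ (List.replicate P.L (μ, true) ++ (List.replicate P.L (ν, true) ++
        (wordRev (stairWord ρ (off r)) ++ (List.replicate P.L (ν, false) ++ List.replicate P.L (μ, false))))))) *
      (GaugeField.plaqHol (axialAvg U) ⟨y, μ, ν, hμν⟩)⁻¹ *
      (holAt U (walk (emb y) (stairWord σ (off r) ++ (List.replicate P.L (μ, true) ++ (List.replicate P.L (ν, true) ++
        (wordRev (stairWord ρ (off r)) ++ (List.replicate P.L (ν, false) ++ List.replicate P.L (μ, false))))))))⁻¹ *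
      (holAt U (walk (emb y) (stairWord σ (off r))) * rect U (walkEnd (emb y) (stairWord σ (off r))) μ ν P.L P.L *
        (holAt U (walk (emb y) (stairWord σ (off r))))⁻¹) := by
  rw [holAt_zWord_eq U y μ ν σ τ ρ (off r), plaqHol_axialAvg_eq]
  rw [show loopHol U ⟨y, μ⟩ (r, σ, τ) = _ from loopHol_eq U ⟨y, μ⟩ (r, σ, τ),
    show loopHol U ⟨y.shift μ, ν⟩ (r, τ, ρ) = _ from loopHol_eq U ⟨y.shift μ, ν⟩ (r, τ, ρ),
    show loopHol U ⟨y.shift ν, μ⟩ (r, ω, ρ) = _ from loopHol_eq U ⟨y.shift ν, μ⟩ (r, ω, ρ),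
    show loopHol U ⟨y, ν⟩ (r, σ, ω) = _ from loopHol_eq U ⟨y, ν⟩ (r, σ, ω)]
  simp only [PBond.tgt, holAt_walk_replicate_true, rect]
  rw [walkEnd_stairWord_shift y μ σ τ (off r), walkEnd_stairWord_shift y ν σ ω (off r), shift_shift_comm y ν μ]
  exact key_group_identity _ _ _ _ _ _ _ _ _ _ _ _

/-- The translated square conjugated by the staircase transporter is within `L²δ` of `1` (conjugation invariance + exact Stokes).
[cite: Balaban1985Averaging, (19) p.21] -/
theorem dist1_conj_rect_le (U : GaugeField P j G) {δ : ℝ} (hU : ∀ q : Plaq P j, dist1 (GaugeField.plaqHol U q) ≤ δ)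
    (T : G) (x : Site P j) {μ ν : Fin P.d} (h : μ < ν) :
    dist1 (T * rect U x μ ν P.L P.L * T⁻¹) ≤ (P.L : ℝ) ^ 2 * δ := by
  rw [GaugeGroup.dist1_conj]
  exact dist1_rect_LL_le U hU x h

/-- A LIMITING LETTER: if `x ≤ κ·δ` for every `δ > a` (`κ ≥ 0`), then `x ≤ κ·a` — turns the tree's STRICT small-field hypotheses
(`PlaqSmall δ U`) into bounds at the non-strict level `a`. [folklore] -/
private theorem le_mul_of_forall_gt {x κ a : ℝ} (hκ : 0 ≤ κ) (h : ∀ δ, a < δ → x ≤ κ * δ) : x ≤ κ * a := by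
  by_contra hx
  push Not at hx
  rcases eq_or_lt_of_le hκ with hκ0 | hκ0
  · have h1 := h (a + 1) (by linarith)
    rw [← hκ0] at h1 hx
    simp at h1 hx
    exact absurd h1 (not_le.mpr hx)
  · have h1 := h (a + (x - κ * a) / (2 * κ)) (by
      have : 0 < (x - κ * a) / (2 * κ) := div_pos (by linarith) (by linarith)
      linarith)
    have e : κ * (a + (x - κ * a) / (2 * κ)) = κ * a + (x - κ * a) / 2 := by field_simp
    rw [e] at h1
    linarith

/-- Loop variables of (0.4) at the non-strict level: `∀ q, |U(∂q) − 1| ≤ a` ⇒ `dist1 (loopHol U c i) ≤ (((d+2)L)²/4)·a`. [cite: Balaban1987RG1, (0.4) p.253] -/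
theorem dist1_loopHol_le' {a : ℝ} (ha : 0 ≤ a) {U : GaugeField P j G} (hU : ∀ q : Plaq P j, dist1 (GaugeField.plaqHol U q) ≤ a)
    (c : PBond P (j + 1)) (i : Idx P) : dist1 (loopHol U c i) ≤ ((((P.d + 2) * P.L : ℕ) : ℝ) ^ 2 / 4) * a :=
  le_mul_of_forall_gt (by positivity) fun δ hδ => dist1_loopHol_le (ha.trans hδ.le) (fun q => (hU q).trans_lt hδ) c i

/-- The transport loop `Z` at the non-strict level: `dist1 Z ≤ (((d+4)L)²/4)·a`. [cite: Balaban1985Averaging, (19)–(20) p.21] -/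
theorem dist1_zWord_le {a : ℝ} (ha : 0 ≤ a) {U : GaugeField P j G} (hU : ∀ q : Plaq P j, dist1 (GaugeField.plaqHol U q) ≤ a)
    (y : Site P (j + 1)) (μ ν : Fin P.d) (σ ρ : Equiv.Perm (Fin P.d)) (r : Fin P.d → Fin P.L) :
    dist1 (holAt U (walk (emb y) (stairWord σ (off r) ++ (List.replicate P.L (μ, true) ++ (List.replicate P.L (ν, true) ++
        (wordRev (stairWord ρ (off r)) ++ (List.replicate P.L (ν, false) ++ List.replicate P.L (μ, false)))))))) ≤
      ((((P.d + 4) * P.L : ℕ) : ℝ) ^ 2 / 4) * a := by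
  refine le_mul_of_forall_gt (by positivity) fun δ hδ => ?_
  have hδ0 : 0 ≤ δ := ha.trans hδ.le
  have h := dist1_holAt_le U hδ0 (fun q => (hU q).trans_lt hδ) _ (netDisp_zWord μ ν σ ρ (off r)) (emb y)
  refine h.trans (mul_le_mul_of_nonneg_right ?_ hδ0)
  have hlen : ((stairWord σ (off r) ++ (List.replicate P.L (μ, true) ++ (List.replicate P.L (ν, true) ++
        (wordRev (stairWord ρ (off r)) ++ (List.replicate P.L (ν, false) ++ List.replicate P.L (μ, false)))))).length : ℝ)
      ≤ (((P.d + 4) * P.L : ℕ) : ℝ) := by exact_mod_cast length_zWord_le μ ν σ ρ r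
  have h0 : (0 : ℝ) ≤ ((stairWord σ (off r) ++ (List.replicate P.L (μ, true) ++ (List.replicate P.L (ν, true) ++
        (wordRev (stairWord ρ (off r)) ++ (List.replicate P.L (ν, false) ++ List.replicate P.L (μ, false)))))).length : ℝ) :=
    Nat.cast_nonneg _
  gcongr

end Coupled

/-! ## §6 [Balaban1985Averaging] Proposition 1 (51) for the (0.4) averaging of [Balaban1987RG1], SHARP FORM -/

section Main

open T4Continuum BlockAveraging AveragingRT ExpMeanLog LatticeWordStokes B10Eq47AxialChi NormedSpace
open scoped Matrix.Norms.L2Operator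

variable {n : Type*} [Fintype n] [DecidableEq n] [Nonempty n] {P : Params} {j : ℕ}

omit [Nonempty n] in
/-- `uXw − 1 = u(X − 1)w` when `uw = 1`. [folklore] -/
private theorem conj_sub_one {u w X : Matrix n n ℂ} (h : u * w = 1) : u * X * w - 1 = u * (X - 1) * w := by
  rw [mul_sub, sub_mul, mul_one, h]

omit [Nonempty n] in
/-- Conjugation passes through a mean. [folklore] -/
private theorem conj_mean {ι : Type*} [Fintype ι] (u w : Matrix n n ℂ) (c : ℂ) (f : ι → Matrix n n ℂ) :
    u * (c • ∑ i, f i) * w = c • ∑ i, (u * f i * w) := by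
  rw [mul_smul_comm, smul_mul_assoc, Finset.mul_sum, Finset.sum_mul]

omit [Fintype n] [DecidableEq n] [Nonempty n] in
/-- The mean of a constant family is the constant. [folklore] -/
private theorem mean_const {ι : Type*} [Fintype ι] [Nonempty ι] (X : Matrix n n ℂ) :
    ((Fintype.card ι : ℂ))⁻¹ • ∑ _i : ι, X = X := by
  have hc : (Fintype.card ι : ℂ) ≠ 0 := Nat.cast_ne_zero.mpr Fintype.card_ne_zero
  rw [Finset.sum_const, Finset.card_univ, ← Nat.cast_smul_eq_nsmul ℂ, smul_smul, inv_mul_cancel₀ hc, one_smul]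

/-- **THE CORRECTION FACTOR IS WITHIN `2θ` OF `1`** when the loop variables are within `θ ≤ ⅙`, `θ < δ_N` (first order `θ` + second
order `6θ² ≤ θ`). [cite: Balaban1987RG1, (0.4) p.253] -/
theorem dist1_corr_le_two_mul (U : GaugeField P j (Matrix.specialUnitaryGroup n ℂ)) (c : PBond P (j + 1)) {θ : ℝ}
    (hθ : ∀ i, dist1 (loopHol U c i) ≤ θ) (hθδ : θ < deltaSU n) (hθ6 : θ ≤ 1 / 6) :
    dist1 (corr (expMeanLogSU (n := n)) U c) ≤ 2 * θ := by
  have h0 : 0 ≤ θ := (GaugeGroup.dist1_nonneg _).trans (hθ (Classical.arbitrary _))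
  have h1 := norm_corr_sub_mean_le U c hθ hθδ (hθ6.trans (by norm_num))
  have hM : ‖((Fintype.card (Idx P) : ℂ))⁻¹ •
      ∑ i, (((loopHol U c i : Matrix.specialUnitaryGroup n ℂ) : Matrix n n ℂ) - 1)‖ ≤ θ :=
    norm_mean_le fun i => by rw [← FederbushMean.dist1_SU_eq]; exact hθ i
  rw [FederbushMean.dist1_SU_eq]
  have e : ((corr (expMeanLogSU (n := n)) U c : Matrix.specialUnitaryGroup n ℂ) : Matrix n n ℂ) - 1 =
      (((corr (expMeanLogSU (n := n)) U c : Matrix.specialUnitaryGroup n ℂ) : Matrix n n ℂ) - 1 -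
        ((Fintype.card (Idx P) : ℂ))⁻¹ • ∑ i, (((loopHol U c i : Matrix.specialUnitaryGroup n ℂ) : Matrix n n ℂ) - 1)) +
      ((Fintype.card (Idx P) : ℂ))⁻¹ • ∑ i, (((loopHol U c i : Matrix.specialUnitaryGroup n ℂ) : Matrix n n ℂ) - 1) := by
    abel
  rw [e]
  refine (norm_add_le _ _).trans ?_
  nlinarith

/-- The TRANSPORTED correction factor to second order: `‖(gκ_c g* − 1) − |I|⁻¹Σᵢ g(Wᵢ − 1)g*‖ ≤ 6θ²`. [cite: Balaban1987RG1, (0.4) p.253] -/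
theorem norm_conj_corr_sub_mean_le (U : GaugeField P j (Matrix.specialUnitaryGroup n ℂ)) (c : PBond P (j + 1))
    (g : Matrix.specialUnitaryGroup n ℂ) {θ : ℝ} (hθ : ∀ i, dist1 (loopHol U c i) ≤ θ) (hθδ : θ < deltaSU n) (hθ4 : θ ≤ 1 / 4) :
    ‖((g : Matrix n n ℂ) * ((corr (expMeanLogSU (n := n)) U c : Matrix.specialUnitaryGroup n ℂ) : Matrix n n ℂ) *
          star (g : Matrix n n ℂ) - 1) -
        ((Fintype.card (Idx P) : ℂ))⁻¹ • ∑ i, ((g : Matrix n n ℂ) *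
          ((((loopHol U c i : Matrix.specialUnitaryGroup n ℂ) : Matrix n n ℂ) - 1)) * star (g : Matrix n n ℂ))‖ ≤ 6 * θ ^ 2 := by
  rw [conj_sub_one (coe_mul_star_self g), ← conj_mean, ← sub_mul, ← mul_sub, norm_conj_eq]
  exact norm_corr_sub_mean_le U c hθ hθδ hθ4

/-- The transported INVERSE correction factor to second order (inverses read as `star`):
`‖(gκ_c* g* − 1) − |I|⁻¹Σᵢ g(Wᵢ* − 1)g*‖ ≤ 6θ²`. [cite: Balaban1987RG1, (0.4)–(0.5) p.253] -/
theorem norm_conj_corr_star_sub_mean_le (U : GaugeField P j (Matrix.specialUnitaryGroup n ℂ)) (c : PBond P (j + 1))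
    (g : Matrix.specialUnitaryGroup n ℂ) {θ : ℝ} (hθ : ∀ i, dist1 (loopHol U c i) ≤ θ) (hθδ : θ < deltaSU n) (hθ4 : θ ≤ 1 / 4) :
    ‖((g : Matrix n n ℂ) * star ((corr (expMeanLogSU (n := n)) U c : Matrix.specialUnitaryGroup n ℂ) : Matrix n n ℂ) *
          star (g : Matrix n n ℂ) - 1) -
        ((Fintype.card (Idx P) : ℂ))⁻¹ • ∑ i, ((g : Matrix n n ℂ) *
          (star (((loopHol U c i : Matrix.specialUnitaryGroup n ℂ) : Matrix n n ℂ)) - 1) * star (g : Matrix n n ℂ))‖ ≤ 6 * θ ^ 2 := by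
  rw [conj_sub_one (coe_mul_star_self g), ← conj_mean, ← sub_mul, ← mul_sub, norm_conj_eq]
  have h := norm_corr_inv_sub_mean_le U c hθ hθδ hθ4
  simp only [coe_inv_eq_star] at h
  exact h

/-- The INVERSE correction factor to second order (inverses read as `star`). [cite: Balaban1987RG1, (0.4)–(0.5) p.253] -/
theorem norm_corr_star_sub_mean_le (U : GaugeField P j (Matrix.specialUnitaryGroup n ℂ)) (c : PBond P (j + 1))
    {θ : ℝ} (hθ : ∀ i, dist1 (loopHol U c i) ≤ θ) (hθδ : θ < deltaSU n) (hθ4 : θ ≤ 1 / 4) :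
    ‖(star ((corr (expMeanLogSU (n := n)) U c : Matrix.specialUnitaryGroup n ℂ) : Matrix n n ℂ) - 1) -
        ((Fintype.card (Idx P) : ℂ))⁻¹ • ∑ i,
          (star (((loopHol U c i : Matrix.specialUnitaryGroup n ℂ) : Matrix n n ℂ)) - 1)‖ ≤ 6 * θ ^ 2 := by
  have h := norm_corr_inv_sub_mean_le U c hθ hθδ hθ4
  simp only [coe_inv_eq_star] at h
  exact h

/-- **THE COUPLED FIRST-ORDER TERM AT ONE INDEX, FROM ITS ATOMS** (v1.1).  The estimate of `coupled_first_order_le` below with the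
configuration entering ONLY through the sizes of the atoms the proof consumes at the index `(r, σ, τ, ρ, ω)`: the loop variables at the four
bonds of `∂p′` (within `(((d+2)L)²/4)·a`), the transport loop `Z` of this index (within `s = (((d+4)L)²/4)·a`), the straight coarse square and
the translated square `(p′)_x`, `x = walkEnd (emb y) Γ^σ(n)` (within `L²a`) — and NO hypothesis on any other plaquette variable.  This is the
form a LOCAL smallness hypothesis feeds (the printed locality «the bound above depends on bounds for V(∂p) − 1 on Δ(p′)», p. 25: every atom is
a product of plaquette variables near the four blocks of `p′`). [cite: Balaban1985Averaging, Prop. 1 (51) pp.25–26; Balaban1987RG1, (0.4) p.253] -/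
theorem coupled_first_order_le_of_atoms {a : ℝ} (ha : 0 ≤ a) {U : GaugeField P j (Matrix.specialUnitaryGroup n ℂ)}
    (hs6 : ((((P.d + 4) * P.L : ℕ) : ℝ) ^ 2 / 4) * a ≤ 1 / 6)
    (y : Site P (j + 1)) {μ ν : Fin P.d} (hμν : μ < ν) (r : Fin P.d → Fin P.L) (σ τ ρ ω : Equiv.Perm (Fin P.d))
    (hW₁ : ∀ i, dist1 (loopHol U ⟨y, μ⟩ i) ≤ ((((P.d + 2) * P.L : ℕ) : ℝ) ^ 2 / 4) * a)
    (hW₂ : ∀ i, dist1 (loopHol U ⟨y.shift μ, ν⟩ i) ≤ ((((P.d + 2) * P.L : ℕ) : ℝ) ^ 2 / 4) * a)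
    (hW₃ : ∀ i, dist1 (loopHol U ⟨y.shift ν, μ⟩ i) ≤ ((((P.d + 2) * P.L : ℕ) : ℝ) ^ 2 / 4) * a)
    (hW₄ : ∀ i, dist1 (loopHol U ⟨y, ν⟩ i) ≤ ((((P.d + 2) * P.L : ℕ) : ℝ) ^ 2 / 4) * a)
    (hZ : dist1 (holAt U (walk (emb y) (stairWord σ (off r) ++ (List.replicate P.L (μ, true) ++ (List.replicate P.L (ν, true) ++
        (wordRev (stairWord ρ (off r)) ++ (List.replicate P.L (ν, false) ++ List.replicate P.L (μ, false)))))))) ≤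
      ((((P.d + 4) * P.L : ℕ) : ℝ) ^ 2 / 4) * a)
    (hsq : dist1 (rect U (emb y) μ ν P.L P.L) ≤ (P.L : ℝ) ^ 2 * a)
    (hsqσ : dist1 (rect U (walkEnd (emb y) (stairWord σ (off r))) μ ν P.L P.L) ≤ (P.L : ℝ) ^ 2 * a) :
    ‖(((loopHol U ⟨y, μ⟩ (r, σ, τ) : Matrix.specialUnitaryGroup n ℂ) : Matrix n n ℂ) - 1) +
        (((axialAvg U ⟨y, μ⟩ : Matrix.specialUnitaryGroup n ℂ) : Matrix n n ℂ) *
          (((loopHol U ⟨y.shift μ, ν⟩ (r, τ, ρ) : Matrix.specialUnitaryGroup n ℂ) : Matrix n n ℂ) - 1) *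
          star ((axialAvg U ⟨y, μ⟩ : Matrix.specialUnitaryGroup n ℂ) : Matrix n n ℂ)) +
        (((axialAvg U ⟨y, ν⟩ : Matrix.specialUnitaryGroup n ℂ) : Matrix n n ℂ) *
          (star (((loopHol U ⟨y.shift ν, μ⟩ (r, ω, ρ) : Matrix.specialUnitaryGroup n ℂ) : Matrix n n ℂ)) - 1) *
          star ((axialAvg U ⟨y, ν⟩ : Matrix.specialUnitaryGroup n ℂ) : Matrix n n ℂ)) +
        (star (((loopHol U ⟨y, ν⟩ (r, σ, ω) : Matrix.specialUnitaryGroup n ℂ) : Matrix n n ℂ)) - 1) +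
        (((GaugeField.plaqHol (axialAvg U) ⟨y, μ, ν, hμν⟩ : Matrix.specialUnitaryGroup n ℂ) : Matrix n n ℂ) - 1)‖ ≤
      (P.L : ℝ) ^ 2 * a + 15 * (((((P.d + 4) * P.L : ℕ) : ℝ) ^ 2 / 4) * a) ^ 2 := by
  -- constants
  set s : ℝ := ((((P.d + 4) * P.L : ℕ) : ℝ) ^ 2 / 4) * a with hs_def
  set u : ℝ := (P.L : ℝ) ^ 2 * a with hu_def
  have hs0 : 0 ≤ s := by positivity
  have hu0 : 0 ≤ u := by positivity
  have hus : u ≤ s := by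
    rw [hs_def, hu_def]
    have hd : (0 : ℝ) ≤ P.d := Nat.cast_nonneg _
    have : (P.L : ℝ) ^ 2 ≤ (((P.d + 4) * P.L : ℕ) : ℝ) ^ 2 / 4 := by
      push_cast
      nlinarith [sq_nonneg (P.L : ℝ), mul_nonneg hd (sq_nonneg (P.L : ℝ)), mul_nonneg (mul_nonneg hd hd) (sq_nonneg (P.L : ℝ))]
    exact mul_le_mul_of_nonneg_right this ha
  have hθs : ((((P.d + 2) * P.L : ℕ) : ℝ) ^ 2 / 4) * a ≤ s := by
    rw [hs_def]
    apply mul_le_mul_of_nonneg_right _ ha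
    apply div_le_div_of_nonneg_right _ (by norm_num)
    exact_mod_cast Nat.pow_le_pow_left (Nat.mul_le_mul_right P.L (by omega : P.d + 2 ≤ P.d + 4)) 2
  have hs1 : s ≤ 1 := hs6.trans (by norm_num)
  -- the atoms
  set W₁ := loopHol U ⟨y, μ⟩ (r, σ, τ)
  set W₂ := loopHol U ⟨y.shift μ, ν⟩ (r, τ, ρ)
  set W₃ := loopHol U ⟨y.shift ν, μ⟩ (r, ω, ρ)
  set W₄ := loopHol U ⟨y, ν⟩ (r, σ, ω)
  set S₁ := axialAvg U ⟨y, μ⟩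
  set S₄ := axialAvg U ⟨y, ν⟩
  set Qp := GaugeField.plaqHol (axialAvg U) ⟨y, μ, ν, hμν⟩
  set Z := holAt U (walk (emb y) (stairWord σ (off r) ++ (List.replicate P.L (μ, true) ++ (List.replicate P.L (ν, true) ++
        (wordRev (stairWord ρ (off r)) ++ (List.replicate P.L (ν, false) ++ List.replicate P.L (μ, false)))))))
  -- bounds on the atoms
  have hQ : dist1 Qp ≤ u := by
    show dist1 (GaugeField.plaqHol (axialAvg U) ⟨y, μ, ν, hμν⟩) ≤ u
    rw [plaqHol_axialAvg_eq_rect']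
    exact hsq
  -- the group identity, cast to matrices with the translated square kept atomic
  have hid := prod_four_loopHol_eq U y hμν r σ τ ρ ω
  generalize hP : holAt U (walk (emb y) (stairWord σ (off r))) * rect U (walkEnd (emb y) (stairWord σ (off r))) μ ν P.L P.L *
      (holAt U (walk (emb y) (stairWord σ (off r))))⁻¹ = P₀ at hid
  have hP₀ : dist1 P₀ ≤ u := by rw [← hP, GaugeGroup.dist1_conj]; exact hsqσ
  have hidM := congrArg (fun g : Matrix.specialUnitaryGroup n ℂ => (g : Matrix n n ℂ)) hid
  simp only [Submonoid.coe_mul, coe_inv_eq_star] at hidM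
  -- the four-factor expansion
  have h1 : ‖((W₁ : Matrix.specialUnitaryGroup n ℂ) : Matrix n n ℂ) - 1‖ ≤ s := by
    rw [← FederbushMean.dist1_SU_eq]; exact (hW₁ _).trans hθs
  have h2 : ‖(S₁ : Matrix n n ℂ) * ((W₂ : Matrix.specialUnitaryGroup n ℂ) : Matrix n n ℂ) * star (S₁ : Matrix n n ℂ) - 1‖ ≤ s := by
    rw [norm_conj_sub_one_eq (coe_mem_unitaryGroup S₁) (star_coe_mem_unitaryGroup S₁) (coe_mul_star_self S₁), ← FederbushMean.dist1_SU_eq]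
    exact (hW₂ _).trans hθs
  have h3 : ‖(S₄ : Matrix n n ℂ) * star ((W₃ : Matrix.specialUnitaryGroup n ℂ) : Matrix n n ℂ) * star (S₄ : Matrix n n ℂ) - 1‖
      ≤ s := by
    rw [norm_conj_sub_one_eq (coe_mem_unitaryGroup S₄) (star_coe_mem_unitaryGroup S₄) (coe_mul_star_self S₄), norm_star_sub_one,
      ← FederbushMean.dist1_SU_eq]
    exact (hW₃ _).trans hθs
  have h4 : ‖star ((W₄ : Matrix.specialUnitaryGroup n ℂ) : Matrix n n ℂ) - 1‖ ≤ s := by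
    rw [norm_star_sub_one, ← FederbushMean.dist1_SU_eq]; exact (hW₄ _).trans hθs
  have hfour := norm_prod_four_sub_le hs0 hs1 h1 h2 h3 h4
  rw [hidM] at hfour
  -- the key identity
  have hkey := norm_key_identity_le (z := ((Z : Matrix.specialUnitaryGroup n ℂ) : Matrix n n ℂ))
    (w := star ((Z : Matrix.specialUnitaryGroup n ℂ) : Matrix n n ℂ))
    (q := ((Qp : Matrix.specialUnitaryGroup n ℂ) : Matrix n n ℂ)) (q' := star ((Qp : Matrix.specialUnitaryGroup n ℂ) : Matrix n n ℂ))
    (P₀ := ((P₀ : Matrix.specialUnitaryGroup n ℂ) : Matrix n n ℂ))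
    (coe_mul_star_self Z) (by rw [← coe_inv_eq_star, norm_coe_eq_one]) (coe_star_mul_self Qp)
    (by rw [← coe_inv_eq_star, norm_coe_eq_one]) (by rw [norm_coe_eq_one])
  have hz : ‖((Z : Matrix.specialUnitaryGroup n ℂ) : Matrix n n ℂ) - 1‖ ≤ s := by rw [← FederbushMean.dist1_SU_eq]; exact hZ
  have hq : ‖((Qp : Matrix.specialUnitaryGroup n ℂ) : Matrix n n ℂ) - 1‖ ≤ u := by rw [← FederbushMean.dist1_SU_eq]; exact hQ
  have hq' : ‖star ((Qp : Matrix.specialUnitaryGroup n ℂ) : Matrix n n ℂ) - 1‖ ≤ u := by rw [norm_star_sub_one]; exact hq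
  have hp : ‖((P₀ : Matrix.specialUnitaryGroup n ℂ) : Matrix n n ℂ) - 1‖ ≤ u := by rw [← FederbushMean.dist1_SU_eq]; exact hP₀
  have hsec : 2 * ‖((Z : Matrix.specialUnitaryGroup n ℂ) : Matrix n n ℂ) - 1‖ * ‖star ((Qp : Matrix.specialUnitaryGroup n ℂ) :
      Matrix n n ℂ) - 1‖ + ‖star ((Qp : Matrix.specialUnitaryGroup n ℂ) : Matrix n n ℂ) - 1‖ *
      ‖((P₀ : Matrix.specialUnitaryGroup n ℂ) : Matrix n n ℂ) - 1‖ + ‖((Qp : Matrix.specialUnitaryGroup n ℂ) : Matrix n n ℂ) - 1‖ ^ 2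
      ≤ 4 * s ^ 2 := by
    have hz0 := norm_nonneg (((Z : Matrix.specialUnitaryGroup n ℂ) : Matrix n n ℂ) - 1)
    have hq0 := norm_nonneg (star ((Qp : Matrix.specialUnitaryGroup n ℂ) : Matrix n n ℂ) - 1)
    have hp0 := norm_nonneg (((P₀ : Matrix.specialUnitaryGroup n ℂ) : Matrix n n ℂ) - 1)
    have hq00 := norm_nonneg (((Qp : Matrix.specialUnitaryGroup n ℂ) : Matrix n n ℂ) - 1)
    nlinarith [mul_le_mul hz hq' hq0 hs0, mul_le_mul hq' hp hp0 hu0, mul_le_mul hq hq hq00 hu0, mul_le_mul hus hus hu0 hs0,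
      mul_le_mul_of_nonneg_left hus hs0]
  -- conjugation forms of the pieces
  have e2 : (S₁ : Matrix n n ℂ) * (((W₂ : Matrix.specialUnitaryGroup n ℂ) : Matrix n n ℂ) - 1) * star (S₁ : Matrix n n ℂ) =
      (S₁ : Matrix n n ℂ) * ((W₂ : Matrix.specialUnitaryGroup n ℂ) : Matrix n n ℂ) * star (S₁ : Matrix n n ℂ) - 1 :=
    (conj_sub_one (coe_mul_star_self S₁)).symm
  have e3 : (S₄ : Matrix n n ℂ) * (star ((W₃ : Matrix.specialUnitaryGroup n ℂ) : Matrix n n ℂ) - 1) * star (S₄ : Matrix n n ℂ) =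
      (S₄ : Matrix n n ℂ) * star ((W₃ : Matrix.specialUnitaryGroup n ℂ) : Matrix n n ℂ) * star (S₄ : Matrix n n ℂ) - 1 :=
    (conj_sub_one (coe_mul_star_self S₄)).symm
  rw [e2, e3]
  -- assemble
  have etot : (((W₁ : Matrix.specialUnitaryGroup n ℂ) : Matrix n n ℂ) - 1) +
      ((S₁ : Matrix n n ℂ) * ((W₂ : Matrix.specialUnitaryGroup n ℂ) : Matrix n n ℂ) * star (S₁ : Matrix n n ℂ) - 1) +
      ((S₄ : Matrix n n ℂ) * star ((W₃ : Matrix.specialUnitaryGroup n ℂ) : Matrix n n ℂ) * star (S₄ : Matrix n n ℂ) - 1) +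
      (star ((W₄ : Matrix.specialUnitaryGroup n ℂ) : Matrix n n ℂ) - 1) +
      (((Qp : Matrix.specialUnitaryGroup n ℂ) : Matrix n n ℂ) - 1) =
    -(((Z : Matrix.specialUnitaryGroup n ℂ) : Matrix n n ℂ) * star ((Qp : Matrix.specialUnitaryGroup n ℂ) : Matrix n n ℂ) *
        star ((Z : Matrix.specialUnitaryGroup n ℂ) : Matrix n n ℂ) * ((P₀ : Matrix.specialUnitaryGroup n ℂ) : Matrix n n ℂ) - 1 -
        ((((W₁ : Matrix.specialUnitaryGroup n ℂ) : Matrix n n ℂ) - 1) +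
          ((S₁ : Matrix n n ℂ) * ((W₂ : Matrix.specialUnitaryGroup n ℂ) : Matrix n n ℂ) * star (S₁ : Matrix n n ℂ) - 1) +
          ((S₄ : Matrix n n ℂ) * star ((W₃ : Matrix.specialUnitaryGroup n ℂ) : Matrix n n ℂ) * star (S₄ : Matrix n n ℂ) - 1) +
          (star ((W₄ : Matrix.specialUnitaryGroup n ℂ) : Matrix n n ℂ) - 1))) +
      ((((Z : Matrix.specialUnitaryGroup n ℂ) : Matrix n n ℂ) * star ((Qp : Matrix.specialUnitaryGroup n ℂ) : Matrix n n ℂ) *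
        star ((Z : Matrix.specialUnitaryGroup n ℂ) : Matrix n n ℂ) * ((P₀ : Matrix.specialUnitaryGroup n ℂ) : Matrix n n ℂ) - 1) +
        (((Qp : Matrix.specialUnitaryGroup n ℂ) : Matrix n n ℂ) - 1) - (((P₀ : Matrix.specialUnitaryGroup n ℂ) : Matrix n n ℂ) - 1)) +
      (((P₀ : Matrix.specialUnitaryGroup n ℂ) : Matrix n n ℂ) - 1) := by abel
  rw [etot]
  refine (norm_add_le _ _).trans ((add_le_add ((norm_add_le _ _).trans (add_le_add ((norm_neg _).trans_le hfour) hkey)) hp).trans ?_)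
  nlinarith [hsec]

/-- **THE COUPLED FIRST-ORDER TERM AT ONE INDEX IS THE TRANSLATED COARSE SQUARE, UP TO SECOND ORDER.**  For `(r, σ, τ, ρ, ω)`, with
`a₁ = W¹`, `a₂ = S₁W²S₁⁻¹`, `a₃ = S₄(W³)⁻¹S₄⁻¹`, `a₄ = (W⁴)⁻¹` (the four coupled loop variables of `prod_four_loopHol_eq`) and `Q` the straight
coarse plaquette: `‖Σₖ(aₖ − 1) + (Q − 1)‖ ≤ L²a + 15s²`, `s = (((d+4)L)²/4)·a`, whenever all plaquette variables of `U` are within `a` of `1`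
and `s ≤ ⅙`. [cite: Balaban1985Averaging, Prop. 1 (51) p.26; Balaban1987RG1, (0.4) p.253] -/
theorem coupled_first_order_le {a : ℝ} (ha : 0 ≤ a) {U : GaugeField P j (Matrix.specialUnitaryGroup n ℂ)}
    (hU : ∀ q : Plaq P j, dist1 (GaugeField.plaqHol U q) ≤ a) (hs6 : ((((P.d + 4) * P.L : ℕ) : ℝ) ^ 2 / 4) * a ≤ 1 / 6)
    (y : Site P (j + 1)) {μ ν : Fin P.d} (hμν : μ < ν) (r : Fin P.d → Fin P.L) (σ τ ρ ω : Equiv.Perm (Fin P.d)) :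
    ‖(((loopHol U ⟨y, μ⟩ (r, σ, τ) : Matrix.specialUnitaryGroup n ℂ) : Matrix n n ℂ) - 1) +
        (((axialAvg U ⟨y, μ⟩ : Matrix.specialUnitaryGroup n ℂ) : Matrix n n ℂ) *
          (((loopHol U ⟨y.shift μ, ν⟩ (r, τ, ρ) : Matrix.specialUnitaryGroup n ℂ) : Matrix n n ℂ) - 1) *
          star ((axialAvg U ⟨y, μ⟩ : Matrix.specialUnitaryGroup n ℂ) : Matrix n n ℂ)) +
        (((axialAvg U ⟨y, ν⟩ : Matrix.specialUnitaryGroup n ℂ) : Matrix n n ℂ) *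
          (star (((loopHol U ⟨y.shift ν, μ⟩ (r, ω, ρ) : Matrix.specialUnitaryGroup n ℂ) : Matrix n n ℂ)) - 1) *
          star ((axialAvg U ⟨y, ν⟩ : Matrix.specialUnitaryGroup n ℂ) : Matrix n n ℂ)) +
        (star (((loopHol U ⟨y, ν⟩ (r, σ, ω) : Matrix.specialUnitaryGroup n ℂ) : Matrix n n ℂ)) - 1) +
        (((GaugeField.plaqHol (axialAvg U) ⟨y, μ, ν, hμν⟩ : Matrix.specialUnitaryGroup n ℂ) : Matrix n n ℂ) - 1)‖ ≤
      (P.L : ℝ) ^ 2 * a + 15 * (((((P.d + 4) * P.L : ℕ) : ℝ) ^ 2 / 4) * a) ^ 2 :=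
  coupled_first_order_le_of_atoms ha hs6 y hμν r σ τ ρ ω (fun i => dist1_loopHol_le' ha hU _ i)
    (fun i => dist1_loopHol_le' ha hU _ i) (fun i => dist1_loopHol_le' ha hU _ i) (fun i => dist1_loopHol_le' ha hU _ i)
    (dist1_zWord_le ha hU y μ ν σ ρ r) (dist1_rect_LL_le U hU (emb y) hμν) (dist1_rect_LL_le U hU _ hμν)

end Main

/-! ## §7 PROPOSITION 1 (51) FOR (0.4), ASSEMBLED -/

section Prop1

open T4Continuum BlockAveraging AveragingRT ExpMeanLog LatticeWordStokes B10Eq47AxialChi NormedSpace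
open scoped Matrix.Norms.L2Operator

variable {n : Type*} [Fintype n] [DecidableEq n] [Nonempty n] {P : Params} {j : ℕ}

/-- **[Balaban1985Averaging] PROPOSITION 1 (51) FOR THE SYMMETRIC AVERAGING (0.4) OF [Balaban1987RG1] WITH THE PRINTED `exp[mean log]`
ON `SU(N)`, SHARP (SECOND-ORDER) FORM — PROVED.**  If every plaquette variable of the `SU(N)` configuration `U` on `T^{(j)}` is within `a` of
`1` and `s := (((d+4)L)²/4)·a ≤ δ_N/2`, then every plaquette variable of `Ū = avgFun ℰp U` is within `L²a + 143·s²` of `1` — i.e.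
`|Ū(∂p′) − 1| ≤ L²a + C₀(d)(L²a)²` with `C₀(d) = 143(d+4)⁴/16`.  Print: *«|V̄(∂p′) − 1| < L²α₀ + C₀(L²α₀)² (51) … The constant C₀
depends on d and c′₂ depends on d and L»* for the average (42); for (0.4) by [Balaban1987RG1] p. 253 *«The considerations and results of this,
and previous papers, do not depend on any particular averaging operation used; they are valid universally for all averages satisfying the above
properties»*.  MECHANISM: the four correction factors are `exp[mean log]` of loop variables within `θ = (((d+2)L)²/4)·a` of `1`; to first order
each is the mean of its loop variables; COUPLING the four index families around `∂p′` (same block point ⇒ same staircase family, (0.3)) the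
first-order terms telescope into the offset-mean of the translated coarse square `(p′)_x`, within `L²a` of `1` by exact lattice Stokes; every
other term is second order.  No gauge fixing, no range hypothesis.  **v1.1, ATOMISED FORM** (this declaration): the configuration enters ONLY
through the sizes of the atoms — ALL loop variables at the four bonds of `∂p′` (within `(((d+2)L)²/4)·a`: the `exp[mean log]` of each bond is
expanded to second order over its whole index family), every transport loop `Z` (within `(((d+4)L)²/4)·a`), the straight coarse square and every
translated square `(p′)_x` (within `L²a`); the global form `dist1_plaqHol_avgFun_le` and the LOCAL form (walk-local smallness near the four blocks
of `p′`, the printed «for p ⊂ Δ(p′)») are both instances. [cite: Balaban1985Averaging, Prop. 1 (51) pp.25–26] -/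
theorem dist1_plaqHol_avgFun_le_of_atoms {a : ℝ} (ha : 0 ≤ a) {U : GaugeField P j (Matrix.specialUnitaryGroup n ℂ)}
    (hs : ((((P.d + 4) * P.L : ℕ) : ℝ) ^ 2 / 4) * a ≤ deltaSU n / 2) (y : Site P (j + 1)) {μ ν : Fin P.d} (hμν : μ < ν)
    (hW₁ : ∀ i, dist1 (loopHol U ⟨y, μ⟩ i) ≤ ((((P.d + 2) * P.L : ℕ) : ℝ) ^ 2 / 4) * a)
    (hW₂ : ∀ i, dist1 (loopHol U ⟨y.shift μ, ν⟩ i) ≤ ((((P.d + 2) * P.L : ℕ) : ℝ) ^ 2 / 4) * a)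
    (hW₃ : ∀ i, dist1 (loopHol U ⟨y.shift ν, μ⟩ i) ≤ ((((P.d + 2) * P.L : ℕ) : ℝ) ^ 2 / 4) * a)
    (hW₄ : ∀ i, dist1 (loopHol U ⟨y, ν⟩ i) ≤ ((((P.d + 2) * P.L : ℕ) : ℝ) ^ 2 / 4) * a)
    (hZ : ∀ (r : Fin P.d → Fin P.L) (σ ρ : Equiv.Perm (Fin P.d)),
      dist1 (holAt U (walk (emb y) (stairWord σ (off r) ++ (List.replicate P.L (μ, true) ++ (List.replicate P.L (ν, true) ++
        (wordRev (stairWord ρ (off r)) ++ (List.replicate P.L (ν, false) ++ List.replicate P.L (μ, false)))))))) ≤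
      ((((P.d + 4) * P.L : ℕ) : ℝ) ^ 2 / 4) * a)
    (hsq : dist1 (rect U (emb y) μ ν P.L P.L) ≤ (P.L : ℝ) ^ 2 * a)
    (hsqσ : ∀ (r : Fin P.d → Fin P.L) (σ : Equiv.Perm (Fin P.d)),
      dist1 (rect U (walkEnd (emb y) (stairWord σ (off r))) μ ν P.L P.L) ≤ (P.L : ℝ) ^ 2 * a) :
    dist1 (GaugeField.plaqHol (avgFun (expMeanLogSU (n := n)) U) ⟨y, μ, ν, hμν⟩) ≤
      (P.L : ℝ) ^ 2 * a + 143 * (((((P.d + 4) * P.L : ℕ) : ℝ) ^ 2 / 4) * a) ^ 2 := by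
  -- constants
  set s : ℝ := ((((P.d + 4) * P.L : ℕ) : ℝ) ^ 2 / 4) * a with hs_def
  set θ : ℝ := ((((P.d + 2) * P.L : ℕ) : ℝ) ^ 2 / 4) * a with hθ_def
  set u : ℝ := (P.L : ℝ) ^ 2 * a with hu_def
  have hδ3 : deltaSU n ≤ 1 / 3 := min_le_left _ _
  have hδ0 : 0 < deltaSU n := deltaSU_pos
  have hs0 : 0 ≤ s := by positivity
  have hθ0 : 0 ≤ θ := by positivity
  have hu0 : 0 ≤ u := by positivity
  have hs6 : s ≤ 1 / 6 := by linarith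
  have hθs : θ ≤ s := by
    rw [hs_def, hθ_def]
    apply mul_le_mul_of_nonneg_right _ ha
    apply div_le_div_of_nonneg_right _ (by norm_num)
    exact_mod_cast Nat.pow_le_pow_left (Nat.mul_le_mul_right P.L (by omega : P.d + 2 ≤ P.d + 4)) 2
  have hus : u ≤ s := by
    rw [hs_def, hu_def]
    have hd : (0 : ℝ) ≤ P.d := Nat.cast_nonneg _
    have : (P.L : ℝ) ^ 2 ≤ (((P.d + 4) * P.L : ℕ) : ℝ) ^ 2 / 4 := by
      push_cast
      nlinarith [sq_nonneg (P.L : ℝ), mul_nonneg hd (sq_nonneg (P.L : ℝ)), mul_nonneg (mul_nonneg hd hd) (sq_nonneg (P.L : ℝ))]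
    exact mul_le_mul_of_nonneg_right this ha
  have hθδ : θ < deltaSU n := by linarith
  have hθ6 : θ ≤ 1 / 6 := hθs.trans hs6
  have hθ4 : θ ≤ 1 / 4 := hθ6.trans (by norm_num)
  haveI : Nonempty (Fin P.d → Fin P.L) := ⟨fun _ => ⟨0, P.L_pos⟩⟩
  -- atoms
  set κ₁ := corr (expMeanLogSU (n := n)) U ⟨y, μ⟩
  set κ₂ := corr (expMeanLogSU (n := n)) U ⟨y.shift μ, ν⟩
  set κ₃ := corr (expMeanLogSU (n := n)) U ⟨y.shift ν, μ⟩
  set κ₄ := corr (expMeanLogSU (n := n)) U ⟨y, ν⟩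
  set S₁ := axialAvg U ⟨y, μ⟩
  set S₄ := axialAvg U ⟨y, ν⟩
  set Qp := GaugeField.plaqHol (axialAvg U) ⟨y, μ, ν, hμν⟩
  have h5 : GaugeField.plaqHol (avgFun (expMeanLogSU (n := n)) U) ⟨y, μ, ν, hμν⟩ =
      κ₁ * (S₁ * κ₂ * S₁⁻¹) * Qp * (S₄ * κ₃⁻¹ * S₄⁻¹) * κ₄⁻¹ := by
    rw [plaqHol_avgFun_eq_five, ← plaqHol_axialAvg_eq]
  rw [FederbushMean.dist1_SU_eq, h5]
  simp only [Submonoid.coe_mul, coe_inv_eq_star]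
  -- the five factors are within `2s` of `1`
  have hb0 : (0 : ℝ) ≤ 2 * s := by positivity
  have hb1 : 2 * s ≤ 1 := by linarith
  have hκ : ∀ c : PBond P (j + 1), (∀ i, dist1 (loopHol U c i) ≤ θ) →
      ‖((corr (expMeanLogSU (n := n)) U c : Matrix.specialUnitaryGroup n ℂ) : Matrix n n ℂ) - 1‖ ≤ 2 * s := fun c hWc => by
    rw [← FederbushMean.dist1_SU_eq]; exact (dist1_corr_le_two_mul U c hWc hθδ hθ6).trans (by linarith)
  have h1 : ‖((κ₁ : Matrix.specialUnitaryGroup n ℂ) : Matrix n n ℂ) - 1‖ ≤ 2 * s := hκ _ hW₁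
  have h2 : ‖(S₁ : Matrix n n ℂ) * ((κ₂ : Matrix.specialUnitaryGroup n ℂ) : Matrix n n ℂ) * star (S₁ : Matrix n n ℂ) - 1‖ ≤ 2 * s := by
    rw [norm_conj_sub_one_eq (coe_mem_unitaryGroup S₁) (star_coe_mem_unitaryGroup S₁) (coe_mul_star_self S₁)]; exact hκ _ hW₂
  have hq : ‖((Qp : Matrix.specialUnitaryGroup n ℂ) : Matrix n n ℂ) - 1‖ ≤ 2 * s := by
    rw [← FederbushMean.dist1_SU_eq, show Qp = GaugeField.plaqHol (axialAvg U) ⟨y, μ, ν, hμν⟩ from rfl, plaqHol_axialAvg_eq_rect']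
    exact hsq.trans (hus.trans (by linarith))
  have h3 : ‖(S₄ : Matrix n n ℂ) * star ((κ₃ : Matrix.specialUnitaryGroup n ℂ) : Matrix n n ℂ) * star (S₄ : Matrix n n ℂ) - 1‖
      ≤ 2 * s := by
    rw [norm_conj_sub_one_eq (coe_mem_unitaryGroup S₄) (star_coe_mem_unitaryGroup S₄) (coe_mul_star_self S₄), norm_star_sub_one]
    exact hκ _ hW₃
  have h4 : ‖star ((κ₄ : Matrix.specialUnitaryGroup n ℂ) : Matrix n n ℂ) - 1‖ ≤ 2 * s := by
    rw [norm_star_sub_one]; exact hκ _ hW₄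
  have hfive := norm_prod_five_sub_le hb0 hb1 h1 h2 hq h3 h4
  -- the coupled index and the four second-order linearisations
  have m1 : ((Fintype.card ((Fin P.d → Fin P.L) × Equiv.Perm (Fin P.d) × Equiv.Perm (Fin P.d) × Equiv.Perm (Fin P.d) ×
        Equiv.Perm (Fin P.d)) : ℂ))⁻¹ • ∑ J : (Fin P.d → Fin P.L) × Equiv.Perm (Fin P.d) × Equiv.Perm (Fin P.d) ×
        Equiv.Perm (Fin P.d) × Equiv.Perm (Fin P.d),
        ((((loopHol U ⟨y, μ⟩ (J.1, J.2.1, J.2.2.1)) : Matrix.specialUnitaryGroup n ℂ) : Matrix n n ℂ) - 1) =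
      ((Fintype.card (Idx P) : ℂ))⁻¹ • ∑ i : Idx P, ((((loopHol U ⟨y, μ⟩ i) : Matrix.specialUnitaryGroup n ℂ) : Matrix n n ℂ) - 1) :=
    mean_couple₁₂ (fun i : Idx P => ((((loopHol U ⟨y, μ⟩ i) : Matrix.specialUnitaryGroup n ℂ) : Matrix n n ℂ) - 1))
  have m2 : ((Fintype.card ((Fin P.d → Fin P.L) × Equiv.Perm (Fin P.d) × Equiv.Perm (Fin P.d) × Equiv.Perm (Fin P.d) ×
        Equiv.Perm (Fin P.d)) : ℂ))⁻¹ • ∑ J : (Fin P.d → Fin P.L) × Equiv.Perm (Fin P.d) × Equiv.Perm (Fin P.d) ×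
        Equiv.Perm (Fin P.d) × Equiv.Perm (Fin P.d),
        ((S₁ : Matrix n n ℂ) * ((((loopHol U ⟨y.shift μ, ν⟩ (J.1, J.2.2.1, J.2.2.2.1)) : Matrix.specialUnitaryGroup n ℂ) :
          Matrix n n ℂ) - 1) * star (S₁ : Matrix n n ℂ)) =
      ((Fintype.card (Idx P) : ℂ))⁻¹ • ∑ i : Idx P, ((S₁ : Matrix n n ℂ) *
        ((((loopHol U ⟨y.shift μ, ν⟩ i) : Matrix.specialUnitaryGroup n ℂ) : Matrix n n ℂ) - 1) * star (S₁ : Matrix n n ℂ)) :=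
    mean_couple₂₃ (fun i : Idx P => (S₁ : Matrix n n ℂ) *
      ((((loopHol U ⟨y.shift μ, ν⟩ i) : Matrix.specialUnitaryGroup n ℂ) : Matrix n n ℂ) - 1) * star (S₁ : Matrix n n ℂ))
  have m3 : ((Fintype.card ((Fin P.d → Fin P.L) × Equiv.Perm (Fin P.d) × Equiv.Perm (Fin P.d) × Equiv.Perm (Fin P.d) ×
        Equiv.Perm (Fin P.d)) : ℂ))⁻¹ • ∑ J : (Fin P.d → Fin P.L) × Equiv.Perm (Fin P.d) × Equiv.Perm (Fin P.d) ×
        Equiv.Perm (Fin P.d) × Equiv.Perm (Fin P.d),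
        ((S₄ : Matrix n n ℂ) * (star ((((loopHol U ⟨y.shift ν, μ⟩ (J.1, J.2.2.2.2, J.2.2.2.1)) : Matrix.specialUnitaryGroup n ℂ) :
          Matrix n n ℂ)) - 1) * star (S₄ : Matrix n n ℂ)) =
      ((Fintype.card (Idx P) : ℂ))⁻¹ • ∑ i : Idx P, ((S₄ : Matrix n n ℂ) *
        (star ((((loopHol U ⟨y.shift ν, μ⟩ i) : Matrix.specialUnitaryGroup n ℂ) : Matrix n n ℂ)) - 1) * star (S₄ : Matrix n n ℂ)) :=
    mean_couple₅₄ (fun i : Idx P => (S₄ : Matrix n n ℂ) *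
      (star ((((loopHol U ⟨y.shift ν, μ⟩ i) : Matrix.specialUnitaryGroup n ℂ) : Matrix n n ℂ)) - 1) * star (S₄ : Matrix n n ℂ))
  have m4 : ((Fintype.card ((Fin P.d → Fin P.L) × Equiv.Perm (Fin P.d) × Equiv.Perm (Fin P.d) × Equiv.Perm (Fin P.d) ×
        Equiv.Perm (Fin P.d)) : ℂ))⁻¹ • ∑ J : (Fin P.d → Fin P.L) × Equiv.Perm (Fin P.d) × Equiv.Perm (Fin P.d) ×
        Equiv.Perm (Fin P.d) × Equiv.Perm (Fin P.d),
        (star ((((loopHol U ⟨y, ν⟩ (J.1, J.2.1, J.2.2.2.2)) : Matrix.specialUnitaryGroup n ℂ) : Matrix n n ℂ)) - 1) =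
      ((Fintype.card (Idx P) : ℂ))⁻¹ • ∑ i : Idx P, (star ((((loopHol U ⟨y, ν⟩ i) : Matrix.specialUnitaryGroup n ℂ) :
        Matrix n n ℂ)) - 1) :=
    mean_couple₁₅ (fun i : Idx P => star ((((loopHol U ⟨y, ν⟩ i) : Matrix.specialUnitaryGroup n ℂ) : Matrix n n ℂ)) - 1)
  have e1 := norm_corr_sub_mean_le U ⟨y, μ⟩ hW₁ hθδ hθ4
  rw [← m1] at e1
  have e2 := norm_conj_corr_sub_mean_le U ⟨y.shift μ, ν⟩ S₁ hW₂ hθδ hθ4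
  rw [← m2] at e2
  have e3 := norm_conj_corr_star_sub_mean_le U ⟨y.shift ν, μ⟩ S₄ hW₃ hθδ hθ4
  rw [← m3] at e3
  have e4 := norm_corr_star_sub_mean_le U ⟨y, ν⟩ hW₄ hθδ hθ4
  rw [← m4] at e4
  -- the per-index estimate, averaged
  have hJ : ∀ J : (Fin P.d → Fin P.L) × Equiv.Perm (Fin P.d) × Equiv.Perm (Fin P.d) × Equiv.Perm (Fin P.d) × Equiv.Perm (Fin P.d),
      ‖((((loopHol U ⟨y, μ⟩ (J.1, J.2.1, J.2.2.1)) : Matrix.specialUnitaryGroup n ℂ) : Matrix n n ℂ) - 1) +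
        ((S₁ : Matrix n n ℂ) * ((((loopHol U ⟨y.shift μ, ν⟩ (J.1, J.2.2.1, J.2.2.2.1)) : Matrix.specialUnitaryGroup n ℂ) :
          Matrix n n ℂ) - 1) * star (S₁ : Matrix n n ℂ)) +
        ((S₄ : Matrix n n ℂ) * (star ((((loopHol U ⟨y.shift ν, μ⟩ (J.1, J.2.2.2.2, J.2.2.2.1)) : Matrix.specialUnitaryGroup n ℂ) :
          Matrix n n ℂ)) - 1) * star (S₄ : Matrix n n ℂ)) +
        (star ((((loopHol U ⟨y, ν⟩ (J.1, J.2.1, J.2.2.2.2)) : Matrix.specialUnitaryGroup n ℂ) : Matrix n n ℂ)) - 1) +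
        (((Qp : Matrix.specialUnitaryGroup n ℂ) : Matrix n n ℂ) - 1)‖ ≤ u + 15 * s ^ 2 :=
    fun J => coupled_first_order_le_of_atoms ha hs6 y hμν J.1 J.2.1 J.2.2.1 J.2.2.2.1 J.2.2.2.2 hW₁ hW₂ hW₃ hW₄ (hZ _ _ _) hsq
      (hsqσ _ _)
  have hmean := norm_mean_le hJ
  simp only [Finset.sum_add_distrib, smul_add, mean_const] at hmean
  -- assemble
  have etot : ∀ (x₁ x₂ q x₃ x₄ f₁ f₂ f₃ f₄ : Matrix n n ℂ), x₁ * x₂ * q * x₃ * x₄ - 1 =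
      (x₁ * x₂ * q * x₃ * x₄ - 1 - ((x₁ - 1) + (x₂ - 1) + (q - 1) + (x₃ - 1) + (x₄ - 1))) +
      (((x₁ - 1) - f₁) + ((x₂ - 1) - f₂) + ((x₃ - 1) - f₃) + ((x₄ - 1) - f₄)) +
      (f₁ + f₂ + f₃ + f₄ + (q - 1)) := fun _ _ _ _ _ _ _ _ _ => by abel
  rw [etot _ _ _ _ _
    (((Fintype.card ((Fin P.d → Fin P.L) × Equiv.Perm (Fin P.d) × Equiv.Perm (Fin P.d) × Equiv.Perm (Fin P.d) ×
        Equiv.Perm (Fin P.d)) : ℂ))⁻¹ • ∑ J : (Fin P.d → Fin P.L) × Equiv.Perm (Fin P.d) × Equiv.Perm (Fin P.d) ×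
        Equiv.Perm (Fin P.d) × Equiv.Perm (Fin P.d),
        ((((loopHol U ⟨y, μ⟩ (J.1, J.2.1, J.2.2.1)) : Matrix.specialUnitaryGroup n ℂ) : Matrix n n ℂ) - 1))
    (((Fintype.card ((Fin P.d → Fin P.L) × Equiv.Perm (Fin P.d) × Equiv.Perm (Fin P.d) × Equiv.Perm (Fin P.d) ×
        Equiv.Perm (Fin P.d)) : ℂ))⁻¹ • ∑ J : (Fin P.d → Fin P.L) × Equiv.Perm (Fin P.d) × Equiv.Perm (Fin P.d) ×
        Equiv.Perm (Fin P.d) × Equiv.Perm (Fin P.d),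
        ((S₁ : Matrix n n ℂ) * ((((loopHol U ⟨y.shift μ, ν⟩ (J.1, J.2.2.1, J.2.2.2.1)) : Matrix.specialUnitaryGroup n ℂ) :
          Matrix n n ℂ) - 1) * star (S₁ : Matrix n n ℂ)))
    (((Fintype.card ((Fin P.d → Fin P.L) × Equiv.Perm (Fin P.d) × Equiv.Perm (Fin P.d) × Equiv.Perm (Fin P.d) ×
        Equiv.Perm (Fin P.d)) : ℂ))⁻¹ • ∑ J : (Fin P.d → Fin P.L) × Equiv.Perm (Fin P.d) × Equiv.Perm (Fin P.d) ×
        Equiv.Perm (Fin P.d) × Equiv.Perm (Fin P.d),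
        ((S₄ : Matrix n n ℂ) * (star ((((loopHol U ⟨y.shift ν, μ⟩ (J.1, J.2.2.2.2, J.2.2.2.1)) : Matrix.specialUnitaryGroup n ℂ) :
          Matrix n n ℂ)) - 1) * star (S₄ : Matrix n n ℂ)))
    (((Fintype.card ((Fin P.d → Fin P.L) × Equiv.Perm (Fin P.d) × Equiv.Perm (Fin P.d) × Equiv.Perm (Fin P.d) ×
        Equiv.Perm (Fin P.d)) : ℂ))⁻¹ • ∑ J : (Fin P.d → Fin P.L) × Equiv.Perm (Fin P.d) × Equiv.Perm (Fin P.d) ×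
        Equiv.Perm (Fin P.d) × Equiv.Perm (Fin P.d),
        (star ((((loopHol U ⟨y, ν⟩ (J.1, J.2.1, J.2.2.2.2)) : Matrix.specialUnitaryGroup n ℂ) : Matrix n n ℂ)) - 1))]
  refine (norm_add_le _ _).trans ((add_le_add ((norm_add_le _ _).trans (add_le_add hfive
    ((norm_add_le _ _).trans (add_le_add ((norm_add_le _ _).trans (add_le_add ((norm_add_le _ _).trans (add_le_add e1 e2)) e3)) e4))))
    hmean).trans ?_)
  nlinarith [mul_le_mul hθs hθs hθ0 hs0]

/-- **[Balaban1985Averaging] PROPOSITION 1 (51) FOR THE SYMMETRIC AVERAGING (0.4) OF [Balaban1987RG1] WITH THE PRINTED `exp[mean log]`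
ON `SU(N)`, SHARP (SECOND-ORDER) FORM — PROVED.**  If every plaquette variable of the `SU(N)` configuration `U` on `T^{(j)}` is within `a` of
`1` and `s := (((d+4)L)²/4)·a ≤ δ_N/2`, then every plaquette variable of `Ū = avgFun ℰp U` is within `L²a + 143·s²` of `1` — i.e.
`|Ū(∂p′) − 1| ≤ L²a + C₀(d)(L²a)²` with `C₀(d) = 143(d+4)⁴/16`.  Print: *«|V̄(∂p′) − 1| < L²α₀ + C₀(L²α₀)² (51) … The constant C₀
depends on d and c′₂ depends on d and L»* for the average (42); for (0.4) by [Balaban1987RG1] p. 253 *«The considerations and results of this,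
and previous papers, do not depend on any particular averaging operation used; they are valid universally for all averages satisfying the above
properties»*.  MECHANISM: the four correction factors are `exp[mean log]` of loop variables within `θ = (((d+2)L)²/4)·a` of `1`; to first order
each is the mean of its loop variables; COUPLING the four index families around `∂p′` (same block point ⇒ same staircase family, (0.3)) the
first-order terms telescope into the offset-mean of the translated coarse square `(p′)_x`, within `L²a` of `1` by exact lattice Stokes; every
other term is second order.  No gauge fixing, no range hypothesis.  (v1.1: the global letters `dist1_loopHol_le'`, `dist1_zWord_le`,
`dist1_rect_LL_le` fed to the atomised form `dist1_plaqHol_avgFun_le_of_atoms`; statement unchanged.) [cite: Balaban1985Averaging, Prop. 1 (51) p.26] -/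
theorem dist1_plaqHol_avgFun_le {a : ℝ} (ha : 0 ≤ a) {U : GaugeField P j (Matrix.specialUnitaryGroup n ℂ)}
    (hU : ∀ q : Plaq P j, dist1 (GaugeField.plaqHol U q) ≤ a)
    (hs : ((((P.d + 4) * P.L : ℕ) : ℝ) ^ 2 / 4) * a ≤ deltaSU n / 2) (p : Plaq P (j + 1)) :
    dist1 (GaugeField.plaqHol (avgFun (expMeanLogSU (n := n)) U) p) ≤
      (P.L : ℝ) ^ 2 * a + 143 * (((((P.d + 4) * P.L : ℕ) : ℝ) ^ 2 / 4) * a) ^ 2 := by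
  obtain ⟨y, μ, ν, hμν⟩ := p
  exact dist1_plaqHol_avgFun_le_of_atoms ha hs y hμν (fun i => dist1_loopHol_le' ha hU _ i) (fun i => dist1_loopHol_le' ha hU _ i)
    (fun i => dist1_loopHol_le' ha hU _ i) (fun i => dist1_loopHol_le' ha hU _ i) (fun r σ ρ => dist1_zWord_le ha hU y μ ν σ ρ r)
    (dist1_rect_LL_le U hU (emb y) hμν) (fun r σ => dist1_rect_LL_le U hU _ hμν)

/-- **`PlaqSmall` FORM OF PROPOSITION 1 FOR (0.4)** (the shape of the schema `T3LowerAlongMinimisersSplit.Prop1EmlAt` for every `d`, `N`, torus):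
`PlaqSmall a U`, `0 ≤ a`, `(((d+4)L)²/4)·a ≤ δ_N/2` ⇒ `PlaqSmall (L²a + 143·((((d+4)L)²/4)·a)²) (blockAvg ℰp U)`. [cite: Balaban1985Averaging, Prop. 1 (51) p.26] -/
theorem plaqSmall_blockAvg_eml_sharp {a : ℝ} (ha : 0 < a) {U : GaugeField P j (Matrix.specialUnitaryGroup n ℂ)}
    (hU : PlaqSmall a U) (hs : ((((P.d + 4) * P.L : ℕ) : ℝ) ^ 2 / 4) * a ≤ deltaSU n / 2) :
    PlaqSmall ((P.L : ℝ) ^ 2 * a + 143 * (((((P.d + 4) * P.L : ℕ) : ℝ) ^ 2 / 4) * a) ^ 2)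
      ((blockAvg (expMeanLogSU (n := n))).avg U) := by
  -- a strictly smaller non-strict level `a′ < a` bounding every plaquette of `U` (finite lattice)
  obtain ⟨a', ha'0, ha'a, hU'⟩ : ∃ a', 0 ≤ a' ∧ a' < a ∧ ∀ q : Plaq P j, dist1 (GaugeField.plaqHol U q) ≤ a' := by
    by_cases hne : (Finset.univ : Finset (Plaq P j)).Nonempty
    · obtain ⟨q₀, -, hq₀⟩ := Finset.exists_mem_eq_sup' hne fun q => dist1 (GaugeField.plaqHol U q)
      refine ⟨Finset.univ.sup' hne fun q => dist1 (GaugeField.plaqHol U q), ?_, ?_, fun q => Finset.le_sup' (fun q => dist1 (GaugeField.plaqHol U q)) (Finset.mem_univ q)⟩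
      · rw [hq₀]; exact GaugeGroup.dist1_nonneg _
      · rw [hq₀]; exact hU q₀
    · refine ⟨0, le_rfl, ha, fun q => ?_⟩
      exact absurd ⟨q, Finset.mem_univ q⟩ hne
  intro p
  rw [blockAvg_avg]
  have hs' : ((((P.d + 4) * P.L : ℕ) : ℝ) ^ 2 / 4) * a' ≤ deltaSU n / 2 :=
    (mul_le_mul_of_nonneg_left ha'a.le (by positivity)).trans hs
  refine (dist1_plaqHol_avgFun_le ha'0 hU' hs' p).trans_lt ?_
  have hL : (0 : ℝ) < (P.L : ℝ) ^ 2 := by have := P.L_pos; positivity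
  have h1 : (P.L : ℝ) ^ 2 * a' < (P.L : ℝ) ^ 2 * a := mul_lt_mul_of_pos_left ha'a hL
  have h2 : (((((P.d + 4) * P.L : ℕ) : ℝ) ^ 2 / 4) * a') ^ 2 ≤ (((((P.d + 4) * P.L : ℕ) : ℝ) ^ 2 / 4) * a) ^ 2 := by
    gcongr
  linarith

end Prop1

/-! ## §8 PROPOSITION 2 (52)–(54) FOR (0.4), UNIFORMLY IN THE NUMBER OF AVERAGINGS -/

section Prop2

open T4Continuum BlockAveraging AveragingRT ExpMeanLog
open scoped Matrix.Norms.L2Operator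

variable {n : Type*} [Fintype n] [DecidableEq n] [Nonempty n] {P : Params}

/-- The level suprema `a_i = sup_{p ⊂ T^{(i)}} |Ū^i(∂p) − 1|` of the (53) induction, as achieved maxima over the finite plaquette sets
(`0` on an empty lattice): every plaquette is below `a_i`, and `a_i` is below any strict uniform bound. [cite: Balaban1985Averaging, (53) p.26] -/
theorem exists_levelSup (V : (i : ℕ) → GaugeField P i (Matrix.specialUnitaryGroup n ℂ)) :
    ∃ a : ℕ → ℝ, (∀ i, 0 ≤ a i) ∧ (∀ i (p : Plaq P i), dist1 (GaugeField.plaqHol (V i) p) ≤ a i) ∧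
      ∀ i (B : ℝ), 0 < B → (∀ p : Plaq P i, dist1 (GaugeField.plaqHol (V i) p) < B) → a i < B := by
  classical
  refine ⟨fun i => if h : (Finset.univ : Finset (Plaq P i)).Nonempty then
      Finset.univ.sup' h (fun p => dist1 (GaugeField.plaqHol (V i) p)) else 0, fun i => ?_, fun i p => ?_, fun i B hB h => ?_⟩
  · dsimp only
    by_cases hne : (Finset.univ : Finset (Plaq P i)).Nonempty
    · rw [dif_pos hne]
      obtain ⟨q₀, -, hq₀⟩ := Finset.exists_mem_eq_sup' hne fun p => dist1 (GaugeField.plaqHol (V i) p)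
      rw [hq₀]; exact GaugeGroup.dist1_nonneg _
    · rw [dif_neg hne]
  · dsimp only
    have hne : (Finset.univ : Finset (Plaq P i)).Nonempty := ⟨p, Finset.mem_univ p⟩
    rw [dif_pos hne]
    exact Finset.le_sup' (fun p => dist1 (GaugeField.plaqHol (V i) p)) (Finset.mem_univ p)
  · dsimp only
    by_cases hne : (Finset.univ : Finset (Plaq P i)).Nonempty
    · rw [dif_pos hne]
      obtain ⟨q₀, -, hq₀⟩ := Finset.exists_mem_eq_sup' hne fun p => dist1 (GaugeField.plaqHol (V i) p)
      rw [hq₀]; exact h q₀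
    · rw [dif_neg hne]; exact hB

omit [DecidableEq n] [Nonempty n] in
/-- The smallness of Proposition 1 from the printed bound on the fine level: `P′ ≤ c′₂ = 2δ_N/((d+4)L)²` gives
`(((d+4)L)²/4)·P′ ≤ δ_N/2`. [cite: Balaban1985Averaging, Prop. 1 p.26] -/
theorem smallness_of_le_c2' {a : ℝ} (h : a ≤ 2 * deltaSU n / (((P.d + 4) * P.L : ℕ) : ℝ) ^ 2) :
    ((((P.d + 4) * P.L : ℕ) : ℝ) ^ 2 / 4) * a ≤ deltaSU n / 2 := by
  have hX : (0 : ℝ) < (((P.d + 4) * P.L : ℕ) : ℝ) ^ 2 := by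
    have := P.L_pos
    positivity
  have key : ∀ X : ℝ, 0 < X → (X / 4) * (2 * deltaSU n / X) = deltaSU n / 2 := fun X hX => by
    field_simp
    ring
  calc ((((P.d + 4) * P.L : ℕ) : ℝ) ^ 2 / 4) * a
      ≤ ((((P.d + 4) * P.L : ℕ) : ℝ) ^ 2 / 4) * (2 * deltaSU n / (((P.d + 4) * P.L : ℕ) : ℝ) ^ 2) :=
        mul_le_mul_of_nonneg_left h (by positivity)
    _ = deltaSU n / 2 := key _ hX

/-- The second-order constant in the two currencies: `143·((((d+4)L)²/4)·a)² = C₀(d)·(L²a)²`, `C₀(d) = 143·((d+4)²/4)²`. [folklore] -/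
private theorem secondOrder_eq (a : ℝ) :
    143 * (((((P.d + 4) * P.L : ℕ) : ℝ) ^ 2 / 4) * a) ^ 2 =
      (143 * ((((P.d + 4 : ℕ) : ℝ)) ^ 2 / 4) ^ 2) * ((P.L : ℝ) ^ 2 * a) ^ 2 := by
  push_cast; ring

/-- **[Balaban1985Averaging] PROPOSITION 2 (52) ⇒ (54) FOR THE SYMMETRIC AVERAGING (0.4) WITH `exp[mean log]` ON `SU(N)`, UNIFORMLY IN
`k` — PROVED.**  For the `k`-fold iterate `Ū^k = Averaging.iter (fun _ => blockAvg ℰp) k U` on the torus: if `|U(∂p) − 1| < α₀η²` for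
every plaquette (`η = L^{−k}`, (52)) with `C₀(d)α₀ ≤ ⅓` and `2α₀ ≤ c′₂(d, L, N) = 2δ_N/((d+4)L)²`, then `|Ū^k(∂p′) − 1| < α₀ + 2C₀(d)α₀²`
for every plaquette of `T^{(k)}` ((54); `C₀(d) = 143·((d+4)²/4)²`).  The (53) induction is the tree's kernel arithmetic `B7.prop2_of_ineq53`
fed with §7's Proposition 1 at every level.  This is the estimate every «regularity of `U` ⇒ regularity of `Ū^j`» step uses for the
averaging OF RECORD `Node00.avOfRecord = blockAvg expMeanLogSU` ([Balaban1987RG1] p. 253's universality sentence, now kernel-checked for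
Props. 1–2). [cite: Balaban1985Averaging, Prop. 2 (52)–(54) p.26] -/
theorem plaqSmall_iter_blockAvg_eml (k : ℕ) {α₀ : ℝ} (hα : 0 < α₀)
    (hα3 : (143 * ((((P.d + 4 : ℕ) : ℝ)) ^ 2 / 4) ^ 2) * α₀ ≤ 1 / 3)
    (hα2 : 2 * α₀ ≤ 2 * deltaSU n / (((P.d + 4) * P.L : ℕ) : ℝ) ^ 2)
    {U : GaugeField P 0 (Matrix.specialUnitaryGroup n ℂ)} (h52 : PlaqSmall (α₀ * (((P.L : ℝ) ^ k)⁻¹) ^ 2) U) :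
    PlaqSmall (α₀ + 2 * (143 * ((((P.d + 4 : ℕ) : ℝ)) ^ 2 / 4) ^ 2) * α₀ ^ 2)
      (Averaging.iter (fun _ => blockAvg (expMeanLogSU (n := n))) k U) := by
  obtain ⟨a, ha0, hale, halt⟩ := exists_levelSup (fun i => Averaging.iter (fun _ => blockAvg (expMeanLogSU (n := n))) i U)
  have hL : (2 : ℝ) ≤ P.L := by exact_mod_cast P.hL.2
  have hLpos : (0 : ℝ) < (P.L : ℝ) ^ k := by have := P.L_pos; positivity
  have hC₀ : (0 : ℝ) < 143 * ((((P.d + 4 : ℕ) : ℝ)) ^ 2 / 4) ^ 2 := by positivity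
  have hmain := B7.prop2_of_ineq53 (P.L : ℝ) (((P.L : ℝ) ^ k)⁻¹) α₀ (143 * ((((P.d + 4 : ℕ) : ℝ)) ^ 2 / 4) ^ 2)
    (2 * deltaSU n / (((P.d + 4) * P.L : ℕ) : ℝ) ^ 2) k a hL (inv_pos.mpr hLpos) (mul_inv_cancel₀ hLpos.ne') hC₀ hα hα3 hα2
    (halt 0 _ (by positivity) h52) ?_
  · exact fun p => (hale k p).trans_lt hmain
  intro i _ Q hQ hQc hai
  have hsm : ((((P.d + 4) * P.L : ℕ) : ℝ) ^ 2 / 4) * a i ≤ deltaSU n / 2 :=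
    (mul_le_mul_of_nonneg_left (hai.le.trans hQc) (by positivity)).trans (smallness_of_le_c2' le_rfl)
  refine halt (i + 1) _ (by positivity) fun p => ?_
  have h1 := dist1_plaqHol_avgFun_le (ha0 i) (hale i) hsm p
  rw [secondOrder_eq] at h1
  refine (show dist1 (GaugeField.plaqHol (Averaging.iter (fun _ => blockAvg (expMeanLogSU (n := n))) (i + 1) U) p) ≤ _ from h1).trans_lt ?_
  have hL2 : (0 : ℝ) < (P.L : ℝ) ^ 2 := by have := P.L_pos; positivity
  have e1 : (P.L : ℝ) ^ 2 * a i < (P.L : ℝ) ^ 2 * Q := mul_lt_mul_of_pos_left hai hL2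
  have e2 : ((P.L : ℝ) ^ 2 * a i) ^ 2 ≤ ((P.L : ℝ) ^ 2 * Q) ^ 2 := by
    have := ha0 i
    gcongr
  nlinarith [mul_le_mul_of_nonneg_left e2 hC₀.le]

/-- **ALL INTERMEDIATE LEVELS (53)**: under the same hypotheses, for every `j ≤ k` the `j`-fold average satisfies
`|Ū^j(∂p) − 1| < 2α₀(L^jη)²`, `η = L^{−k}` — the printed inductive assumption (53) bounded by `2α₀` per level. [cite: Balaban1985Averaging, (53) p.26] -/
theorem plaqSmall_iter_blockAvg_eml_level (k : ℕ) {α₀ : ℝ} (hα : 0 < α₀)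
    (hα3 : (143 * ((((P.d + 4 : ℕ) : ℝ)) ^ 2 / 4) ^ 2) * α₀ ≤ 1 / 3)
    (hα2 : 2 * α₀ ≤ 2 * deltaSU n / (((P.d + 4) * P.L : ℕ) : ℝ) ^ 2)
    {U : GaugeField P 0 (Matrix.specialUnitaryGroup n ℂ)} (h52 : PlaqSmall (α₀ * (((P.L : ℝ) ^ k)⁻¹) ^ 2) U)
    {j : ℕ} (hj : j ≤ k) :
    PlaqSmall (2 * α₀ * ((P.L : ℝ) ^ j * ((P.L : ℝ) ^ k)⁻¹) ^ 2)
      (Averaging.iter (fun _ => blockAvg (expMeanLogSU (n := n))) j U) := by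
  obtain ⟨a, ha0, hale, halt⟩ := exists_levelSup (fun i => Averaging.iter (fun _ => blockAvg (expMeanLogSU (n := n))) i U)
  have hL : (2 : ℝ) ≤ P.L := by exact_mod_cast P.hL.2
  have hLpos : (0 : ℝ) < (P.L : ℝ) ^ k := by have := P.L_pos; positivity
  have hC₀ : (0 : ℝ) < 143 * ((((P.d + 4 : ℕ) : ℝ)) ^ 2 / 4) ^ 2 := by positivity
  have hind := B7.ineq53_induction (P.L : ℝ) (((P.L : ℝ) ^ k)⁻¹) α₀ (143 * ((((P.d + 4 : ℕ) : ℝ)) ^ 2 / 4) ^ 2)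
    (2 * deltaSU n / (((P.d + 4) * P.L : ℕ) : ℝ) ^ 2) k a hL (inv_pos.mpr hLpos) (mul_inv_cancel₀ hLpos.ne').le hC₀ hα hα3 hα2
    (halt 0 _ (by positivity) h52) ?_ j hj
  · intro p
    refine (hale j p).trans_lt (hind.trans_le ?_)
    set x : ℝ := ((P.L : ℝ) ^ j * ((P.L : ℝ) ^ k)⁻¹) ^ 2 with hx
    have hx0 : 0 ≤ x := by positivity
    have hx1 : x ≤ 1 := by
      rw [hx]
      have hjk : (P.L : ℝ) ^ j * ((P.L : ℝ) ^ k)⁻¹ ≤ 1 := by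
        rw [mul_inv_le_iff₀ hLpos, one_mul]
        exact pow_le_pow_right₀ (by linarith) hj
      have h0 : 0 ≤ (P.L : ℝ) ^ j * ((P.L : ℝ) ^ k)⁻¹ := by positivity
      nlinarith
    have hS := B7.geom_bracket_le_two _ (by positivity) (B7.prop2_ratio_lt_half _ α₀ (P.L : ℝ) hL (by positivity) hα3).le j
    have hCa : 0 ≤ 143 * ((((P.d + 4 : ℕ) : ℝ)) ^ 2 / 4) ^ 2 * (α₀ * x) ^ 2 := by positivity
    calc α₀ * x + 143 * ((((P.d + 4 : ℕ) : ℝ)) ^ 2 / 4) ^ 2 * (α₀ * x) ^ 2 *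
          ∑ i ∈ Finset.range j, ((1 + 143 * ((((P.d + 4 : ℕ) : ℝ)) ^ 2 / 4) ^ 2 * α₀) ^ 2 / (P.L : ℝ) ^ 2) ^ i
        ≤ α₀ * x + 143 * ((((P.d + 4 : ℕ) : ℝ)) ^ 2 / 4) ^ 2 * (α₀ * x) ^ 2 * 2 := by gcongr
      _ ≤ 2 * α₀ * x := by
          have hx2 : x * x ≤ x := by nlinarith
          have hαx : 0 ≤ α₀ * x := mul_nonneg hα.le hx0
          have h1 : (α₀ * x) ^ 2 ≤ (α₀ * x) * α₀ := by
            rw [show (α₀ * x) ^ 2 = α₀ * α₀ * (x * x) by ring, show α₀ * x * α₀ = α₀ * α₀ * x by ring]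
            exact mul_le_mul_of_nonneg_left hx2 (by positivity)
          have h2 : 143 * ((((P.d + 4 : ℕ) : ℝ)) ^ 2 / 4) ^ 2 * (α₀ * x) ^ 2 * 2 ≤
              143 * ((((P.d + 4 : ℕ) : ℝ)) ^ 2 / 4) ^ 2 * ((α₀ * x) * α₀) * 2 := by gcongr
          have h3 : 143 * ((((P.d + 4 : ℕ) : ℝ)) ^ 2 / 4) ^ 2 * ((α₀ * x) * α₀) * 2 =
              (143 * ((((P.d + 4 : ℕ) : ℝ)) ^ 2 / 4) ^ 2 * α₀) * (α₀ * x) * 2 := by ring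
          rw [h3] at h2
          have h4 : (143 * ((((P.d + 4 : ℕ) : ℝ)) ^ 2 / 4) ^ 2 * α₀) * (α₀ * x) * 2 ≤ (1 / 3) * (α₀ * x) * 2 := by gcongr
          linarith
  intro i _ Q hQ hQc hai
  have hsm : ((((P.d + 4) * P.L : ℕ) : ℝ) ^ 2 / 4) * a i ≤ deltaSU n / 2 :=
    (mul_le_mul_of_nonneg_left (hai.le.trans hQc) (by positivity)).trans (smallness_of_le_c2' le_rfl)
  refine halt (i + 1) _ (by positivity) fun p => ?_
  have h1 := dist1_plaqHol_avgFun_le (ha0 i) (hale i) hsm p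
  rw [secondOrder_eq] at h1
  refine (show dist1 (GaugeField.plaqHol (Averaging.iter (fun _ => blockAvg (expMeanLogSU (n := n))) (i + 1) U) p) ≤ _ from h1).trans_lt ?_
  have hL2 : (0 : ℝ) < (P.L : ℝ) ^ 2 := by have := P.L_pos; positivity
  have e1 : (P.L : ℝ) ^ 2 * a i < (P.L : ℝ) ^ 2 * Q := mul_lt_mul_of_pos_left hai hL2
  have e2 : ((P.L : ℝ) ^ 2 * a i) ^ 2 ≤ ((P.L : ℝ) ^ 2 * Q) ^ 2 := by
    have := ha0 i
    gcongr
  nlinarith [mul_le_mul_of_nonneg_left e2 hC₀.le]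

/-- **(52) ⇒ (54) IN THE TORUS's OWN UNITS** (`η_k = L^{−k}` is `Params.eta`): `PlaqSmall (α₀·η_k²) U ⇒ PlaqSmall (α₀ + 2C₀α₀²) (Ū^k)`,
hence `⇒ PlaqSmall (2α₀) (Ū^k)`. [cite: Balaban1985Averaging, Prop. 2 (54) p.26] -/
theorem plaqSmall_iter_blockAvg_eml_eta (k : ℕ) {α₀ : ℝ} (hα : 0 < α₀)
    (hα3 : (143 * ((((P.d + 4 : ℕ) : ℝ)) ^ 2 / 4) ^ 2) * α₀ ≤ 1 / 3)
    (hα2 : 2 * α₀ ≤ 2 * deltaSU n / (((P.d + 4) * P.L : ℕ) : ℝ) ^ 2)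
    {U : GaugeField P 0 (Matrix.specialUnitaryGroup n ℂ)} (h52 : PlaqSmall (α₀ * P.eta k ^ 2) U) :
    PlaqSmall (2 * α₀) (Averaging.iter (fun _ => blockAvg (expMeanLogSU (n := n))) k U) := by
  have h52' : PlaqSmall (α₀ * (((P.L : ℝ) ^ k)⁻¹) ^ 2) U := by
    intro p; have := h52 p; rwa [Params.eta, inv_pow] at this
  intro p
  refine (plaqSmall_iter_blockAvg_eml k hα hα3 hα2 h52' p).trans ?_
  exact B7.prop2_bound_lt_two_alpha _ α₀ hα hα3

end Prop2

end Literature.MathematicalPhysics.QuantumFieldTheory.Balaban1983to89.BlockAveragingEMLProp2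

end
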